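import Literature.Computability.Complexity.SuccinctCircuitNames
import Literature.Computability.Complexity.CodeFPTableKit
import HarnessLib

/-!
# The succinct kernel-vector circuit, I: the gate vocabulary (val-lit KV20 M1 programme, step (P6), file B1a)

For a family of integer matrices `A_n` (`R n × N n`, exponential dimensions) whose entries are
computed in polynomial time from `⟨1ⁿ, r, c⟩` (`SuccIntMatrixFamily`), this file DESCRIBES — as a
`SuccCircuit` (p1 g9, `SuccinctCircuitBits.lean`: gates named by strings, syntax in `FP`) — the
variable-free arithmetic circuit over `ℕ` of polynomial depth and exponential size that computes,
entry by entry and split into positive and negative parts, the canonical kernel vector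
`charpolyKernelVector (A_nᵀ A_n)` of `Literature/LinearAlgebra/KernelVectorViaCharpoly.lean` (x5 g6):
`B = AᵀA`, the all-coefficients Mahajan–Vinay matrix `mvCharAdj B` of
`AC/CharpolyCoefficientsExplicitABP.lean` (t20 g10) reindexed by natural labels, its `2^t`-th
powers by repeated squaring (all coefficients `c_i` of `χ_B`), binary powers `B^j`,
`q_B(B)·B^j = Σ_{k'} [c_0 = ⋯ = c_{k'-1} = 0][c_{k'} ≠ 0] Σ_i c_{i+k'} B^{i+j}`, the kernel matrix
`N_B = Σ_{j'} [q_B(B)B^{j'+1} = 0][q_B(B)B^{j'} ≠ 0] q_B(B)B^{j'}` and its least nonzero column —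
every "all zero" test being ONE select gate comparing the two parts of a sum of squares. The gate
vocabulary (31 tags; table in `HOME/np/MEMO-x5g7-KV20-M1-P6-circuit.md` of the val-lit cell) is
written with the naming layer `SuccinctCircuitNames.lean` (x5 g7): names are padded tuples
`[tag, s, f1, …, f6]`, every syntax map is a FIXED arithmetic expression (`CodeFP.AExp`) evaluated
on the name's environment, so that `FP`-uniformity is automatic (`codeFP_geval`, `codeFP_gchild`)
and the `SuccCircuit` axioms reduce to arithmetic on tuples. This file: the vocabulary, the
evaluation lemmas on canonical tuples (per tag: well-formedness, kind, width, arity, depth,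
children). The sequel `SuccinctKernelVectorCircuit.lean` proves the `SuccCircuit` axioms for every
string and assembles the circuit `kvc Φ`; `SuccinctKernelVectorValues.lean` identifies the VALUES
of its gates (the linear algebra).

HONEST FRAMING (val-lit, KV20 M1 programme, RULING (120)): Boolean/arithmetic plumbing for ONE
succinct linear system ("standard small-space linear algebra [BvzGH82, ABO99]", Kumar–Volk); it
proves nothing about `kumarVolk2020_cor_1_3` by itself (census +0); `VP ≠ VNP` is NOT proved.

## References

* P. Koiran, S. Perifel, *VPSPACE and a transfer theorem over the reals*, Comput. Complexity 18
  (2009), §3.2 (Uniform `VPAR⁰`; Prop. 1) [KoiranPerifel2009VPSPACE].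
* M. Mahajan, V. Vinay, *Determinant: old algorithms, new insights*, SIAM J. Discrete Math. 12
  (1999), Thm. 3.2 and §3.1 (p0005.txt:L20–27, p0006.txt:L11–47) [MahajanVinay1999].
* A. Borodin, J. von zur Gathen, J. Hopcroft, *Fast parallel matrix and GCD computations*, Inform.
  and Control 52 (1982), §4–§5 [BorodinVonzurgathenHopcroft1982].
* M. Kumar, B. L. Volk, *A polynomial degree bound on equations for non-rigid matrices and small
  linear circuits*, ACM TOCT 14 (2022), §6 (proof of Cor. 1.3: "solving a linear system … of
  dimension exp(poly(n)) … standard small-space linear algebra") [KumarVolk2022].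
* S. Arora, B. Barak, *Computational Complexity*, CUP 2009, §1.3, §6.8 [AroraBarak2009].
-/

noncomputable section

namespace Literature.Computability.Complexity

open _root_.Computability CodeFP Brick Finset CodeFP.AExp

namespace SuccCircuit

/-! ### Shifting an expression past a child index -/

/-- Shift every scalar variable by one (the child index occupies scalar `0` of a child
environment). [cite: KoiranPerifel2009VPSPACE, §3.2] -/
def bump : AExp → AExp
  | .lit n => .lit n
  | .var j => .var (j + 1)
  | .tbl k e => .tbl k (bump e)
  | .add e₁ e₂ => .add (bump e₁) (bump e₂)
  | .sub e₁ e₂ => .sub (bump e₁) (bump e₂)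
  | .mul e₁ e₂ => .mul (bump e₁) (bump e₂)
  | .div e₁ e₂ => .div (bump e₁) (bump e₂)
  | .emod e₁ e₂ => .emod (bump e₁) (bump e₂)
  | .lt e₁ e₂ => .lt (bump e₁) (bump e₂)
  | .beq e₁ e₂ => .beq (bump e₁) (bump e₂)
  | .cond c e₁ e₂ => .cond (bump c) (bump e₁) (bump e₂)

/-- A shifted expression ignores the child index. [cite: AroraBarak2009, §1.3] -/
@[simp] theorem eval_bump (k : ℕ) (sc : List ℕ) (tb : List (List ℕ)) :
    ∀ e : AExp, (bump e).eval (k :: sc, tb) = e.eval (sc, tb)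
  | .lit n => rfl
  | .var j => by simp [bump]
  | .tbl k' e => by simp [bump, eval_bump k sc tb e]
  | .add e₁ e₂ => by simp [bump, eval_bump k sc tb e₁, eval_bump k sc tb e₂]
  | .sub e₁ e₂ => by simp [bump, eval_bump k sc tb e₁, eval_bump k sc tb e₂]
  | .mul e₁ e₂ => by simp [bump, eval_bump k sc tb e₁, eval_bump k sc tb e₂]
  | .div e₁ e₂ => by simp [bump, eval_bump k sc tb e₁, eval_bump k sc tb e₂]
  | .emod e₁ e₂ => by simp [bump, eval_bump k sc tb e₁, eval_bump k sc tb e₂]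
  | .lt e₁ e₂ => by simp [bump, eval_bump k sc tb e₁, eval_bump k sc tb e₂]
  | .beq e₁ e₂ => by simp [bump, eval_bump k sc tb e₁, eval_bump k sc tb e₂]
  | .cond c e₁ e₂ => by simp [bump, AExp.eval_cond, eval_bump k sc tb c, eval_bump k sc tb e₁, eval_bump k sc tb e₂]

end SuccCircuit

/-! ### Integer matrix families given in polynomial time -/

/-- **A family of integer matrices given in polynomial time**: the `n`-th matrix has `R n` rows and
`N n` columns (binary numerals computed from `1ⁿ`), entries `A n r c` with `|A n r c| < 2^{W₀ n}`
computed from `⟨1ⁿ, r, c⟩` (difference-pair code `intE`), and a field width `F n` (unary from `1ⁿ`)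
with `R n, N n < 2^{F n}`. [cite: AroraBarak2009, §6.8 Def. 6.30 (succinct representation); KumarVolk2022, §6 (proof of Cor. 1.3)] -/
structure SuccIntMatrixFamily where
  /-- number of rows of the `n`-th matrix -/
  R : ℕ → ℕ
  /-- number of columns of the `n`-th matrix -/
  N : ℕ → ℕ
  /-- bit width of the entries -/
  W₀ : ℕ → ℕ
  /-- field width: `R n, N n < 2^{F n}` -/
  F : ℕ → ℕ
  /-- the entries -/
  A : ℕ → ℕ → ℕ → ℤ
  natAbs_lt : ∀ n r c, (A n r c).natAbs < 2 ^ W₀ n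
  R_lt : ∀ n, R n < 2 ^ F n
  N_lt : ∀ n, N n < 2 ^ F n
  R_fp : CodeFP unE natE R
  N_fp : CodeFP unE natE N
  W₀_fp : CodeFP unE natE W₀
  F_fp : CodeFP unE unE F
  A_fp : CodeFP (pairE unE (pairE natE natE)) intE (fun p => A p.1 p.2.1 p.2.2)

namespace SuccIntMatrixFamily

variable (Φ : SuccIntMatrixFamily)

/-- Number of internal labels `(ℓ, t, u)`, `ℓ ≤ N − 2`, `t, u < N`. [cite: MahajanVinay1999, §3.1 (p0006.txt:L11–47)] -/
def Lmid (n : ℕ) : ℕ := (Φ.N n - 1) * (Φ.N n * Φ.N n)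

/-- Number of labels of the all-coefficients program: source, internal states, `N + 1` sinks.
[cite: MahajanVinay1999, §3.1 (p0006.txt:L11–47)] -/
def X (n : ℕ) : ℕ := 1 + (Φ.Lmid n + (Φ.N n + 1))

/-- Number of squarings: `2^T > N`. [cite: MahajanVinay1999, §3.1] -/
def T (n : ℕ) : ℕ := Nat.size (Φ.N n)

/-- Bits per name field. [cite: AroraBarak2009, §0.1] -/
def Fb (n : ℕ) : ℕ := 3 * Φ.F n + 5

/-- The bound on name fields, `2^{Fb}`. [cite: AroraBarak2009, §0.1] -/
def FB (n : ℕ) : ℕ := 2 ^ Φ.Fb n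

/-- The depth bound. [cite: KoiranPerifel2009VPSPACE, §3.2] -/
def dmax (n : ℕ) : ℕ := 4 * Φ.F n + 22

/-- The select width: every compared value is below `2^{Wmux}`. [cite: KoiranPerifel2009VPSPACE, §3.2] -/
def Wmux (n : ℕ) : ℕ := (Φ.W₀ n + 1 + Φ.Fb n) * 2 ^ Φ.dmax n

/-- The required name length: every core of the `n`-th circuit fits. [cite: AroraBarak2009, §0.1] -/
def Lreq (n : ℕ) : ℕ := 2 * n + 2 + 8 * (2 * Φ.Fb n + 2)

/-- The parameters handed to the syntax expressions. [cite: KoiranPerifel2009VPSPACE, §3.2] -/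
def params (n : ℕ) : List ℕ :=
  [Φ.R n, Φ.N n, Φ.W₀ n, Φ.F n, Φ.X n, Φ.T n, Φ.Lmid n, Φ.Wmux n, Φ.Lreq n, Φ.Fb n, Φ.FB n]

/-! #### The parameters are computed in polynomial time from `1ⁿ` -/

/-- `fp_Lmid` (plumbing). [folklore] -/
private theorem fp_Lmid : CodeFP unE natE Φ.Lmid :=
  (natMul.comp ((natSub.comp (Φ.N_fp.pair (const _ 1))).pair (natMul.comp (Φ.N_fp.pair Φ.N_fp)))).congr fun _ => rfl

/-- `fp_X` (plumbing). [folklore] -/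
private theorem fp_X : CodeFP unE natE Φ.X :=
  (natAdd.comp ((const _ 1).pair (natAdd.comp (Φ.fp_Lmid.pair (natAdd.comp (Φ.N_fp.pair (const _ 1))))))).congr
    fun _ => rfl

/-- `fp_size` (plumbing). [folklore] -/
private theorem fp_size : CodeFP natE natE Nat.size := (strNatLength.comp strOfNat).congr fun a => length_natE a

/-- `fp_T` (plumbing). [folklore] -/
private theorem fp_T : CodeFP unE natE Φ.T := (fp_size.comp Φ.N_fp).congr fun _ => rfl

/-- `Fb` in unary. [folklore] -/
private theorem fp_Fb_un : CodeFP unE unE Φ.Fb :=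
  (unAdd.comp ((unAdd.comp (Φ.F_fp.pair (unAdd.comp (Φ.F_fp.pair Φ.F_fp)))).pair (const _ 5))).congr fun n => by
    show Φ.F n + (Φ.F n + Φ.F n) + 5 = Φ.Fb n; unfold Fb; ring

/-- `fp_Fb` (plumbing). [folklore] -/
private theorem fp_Fb : CodeFP unE natE Φ.Fb := natOfUn.comp Φ.fp_Fb_un

/-- `fp_FB` (plumbing). [folklore] -/
private theorem fp_FB : CodeFP unE natE Φ.FB :=
  (natPow.comp ((const _ 2).pair Φ.fp_Fb_un)).congr fun _ => rfl

/-- `fp_dmax_un` (plumbing). [folklore] -/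
private theorem fp_dmax_un : CodeFP unE unE Φ.dmax :=
  (unAdd.comp ((unAdd.comp ((unAdd.comp (Φ.F_fp.pair Φ.F_fp)).pair (unAdd.comp (Φ.F_fp.pair Φ.F_fp)))).pair
    (const _ 22))).congr fun n => by
    show Φ.F n + Φ.F n + (Φ.F n + Φ.F n) + 22 = Φ.dmax n; unfold dmax; ring

/-- `fp_Wmux` (plumbing). [folklore] -/
private theorem fp_Wmux : CodeFP unE natE Φ.Wmux :=
  (natMul.comp ((natAdd.comp ((natAdd.comp (Φ.W₀_fp.pair (const _ 1))).pair Φ.fp_Fb)).pair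
    (natPow.comp ((const _ 2).pair Φ.fp_dmax_un)))).congr fun _ => rfl

/-- `fp_Lreq` (plumbing). [folklore] -/
private theorem fp_Lreq : CodeFP unE natE Φ.Lreq :=
  (natAdd.comp ((natAdd.comp ((natMul.comp ((const _ 2).pair natOfUn)).pair (const _ 2))).pair
    (natMul.comp ((const _ 8).pair (natAdd.comp ((natMul.comp ((const _ 2).pair Φ.fp_Fb)).pair (const _ 2))))))).congr
    fun _ => rfl

/-- **The parameters are an `FP` function of `1ⁿ`.** [cite: AroraBarak2009, §1.3] -/
theorem params_fp : CodeFP unE (rawE natE) Φ.params :=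
  codeFP_consNat Φ.R_fp (codeFP_consNat Φ.N_fp (codeFP_consNat Φ.W₀_fp (codeFP_consNat (natOfUn.comp Φ.F_fp)
    (codeFP_consNat Φ.fp_X (codeFP_consNat Φ.fp_T (codeFP_consNat Φ.fp_Lmid (codeFP_consNat Φ.fp_Wmux
    (codeFP_consNat Φ.fp_Lreq (codeFP_consNat Φ.fp_Fb (codeFP_consNat Φ.fp_FB (const _ [])))))))))))

/-! #### Sizes of the parameters -/

/-- `T_le_F` (plumbing). [cite: AroraBarak2009, §1.3 (polynomial-time arithmetic on binary numerals)] -/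
theorem T_le_F (n : ℕ) : Φ.T n ≤ Φ.F n := Nat.size_le.2 (Φ.N_lt n)

/-- `two_pow_T` (plumbing). [cite: AroraBarak2009, §1.3 (polynomial-time arithmetic on binary numerals)] -/
theorem two_pow_T (n : ℕ) : Φ.N n < 2 ^ Φ.T n := Nat.lt_size_self _

/-- `X_le` (plumbing). [cite: AroraBarak2009, §1.3 (polynomial-time arithmetic on binary numerals)] -/
theorem X_le (n : ℕ) : Φ.X n ≤ 2 ^ (3 * Φ.F n + 1) := by
  have hN := Φ.N_lt n
  have h3 : Φ.N n * (Φ.N n * Φ.N n) < 2 ^ (3 * Φ.F n) := by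
    have := Nat.mul_lt_mul'' (Nat.mul_lt_mul'' hN hN) hN
    rw [← pow_add, ← pow_add, show Φ.F n + Φ.F n + Φ.F n = 3 * Φ.F n by ring] at this
    simpa [Nat.mul_assoc] using this
  have hX : Φ.X n ≤ Φ.N n * (Φ.N n * Φ.N n) + 2 := by
    unfold X Lmid
    rcases Nat.eq_zero_or_pos (Φ.N n) with hz | hp
    · rw [hz]
    · obtain ⟨m, hm⟩ : ∃ m, Φ.N n = m + 1 := ⟨Φ.N n - 1, by omega⟩
      rw [hm, Nat.add_sub_cancel]
      nlinarith [Nat.zero_le m, sq_nonneg m]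
  have h1 : 1 ≤ 2 ^ (3 * Φ.F n) := Nat.one_le_two_pow
  rw [pow_succ]; omega

/-- `FB_ge` (plumbing). [cite: AroraBarak2009, §1.3 (polynomial-time arithmetic on binary numerals)] -/
theorem FB_ge (n : ℕ) : 32 ≤ Φ.FB n := by
  unfold FB Fb
  calc (32:ℕ) = 2 ^ 5 := by norm_num
    _ ≤ 2 ^ (3 * Φ.F n + 5) := Nat.pow_le_pow_right (by norm_num) (by omega)

/-- `two_X_le_FB` (plumbing). [cite: AroraBarak2009, §1.3 (polynomial-time arithmetic on binary numerals)] -/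
theorem two_X_le_FB (n : ℕ) : 2 * Φ.X n ≤ Φ.FB n := by
  have := Φ.X_le n
  unfold FB Fb
  calc 2 * Φ.X n ≤ 2 * 2 ^ (3 * Φ.F n + 1) := by omega
    _ = 2 ^ (3 * Φ.F n + 2) := by rw [pow_succ]; ring
    _ ≤ 2 ^ (3 * Φ.F n + 5) := Nat.pow_le_pow_right (by norm_num) (by omega)

/-- `two_R_le_FB` (plumbing). [cite: AroraBarak2009, §1.3 (polynomial-time arithmetic on binary numerals)] -/
theorem two_R_le_FB (n : ℕ) : 2 * Φ.R n ≤ Φ.FB n := by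
  have := Φ.R_lt n
  unfold FB Fb
  calc 2 * Φ.R n ≤ 2 * 2 ^ Φ.F n := by omega
    _ = 2 ^ (Φ.F n + 1) := by rw [pow_succ]; ring
    _ ≤ 2 ^ (3 * Φ.F n + 5) := Nat.pow_le_pow_right (by norm_num) (by omega)

/-- `two_NN_le_FB` (plumbing). [cite: AroraBarak2009, §1.3 (polynomial-time arithmetic on binary numerals)] -/
theorem two_NN_le_FB (n : ℕ) : 2 * (Φ.N n * Φ.N n) ≤ Φ.FB n := by
  have hN := Φ.N_lt n
  unfold FB Fb
  have : Φ.N n * Φ.N n < 2 ^ (2 * Φ.F n) := by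
    have := Nat.mul_lt_mul'' hN hN; rw [← pow_add] at this; rw [two_mul]; exact this
  calc 2 * (Φ.N n * Φ.N n) ≤ 2 * 2 ^ (2 * Φ.F n) := by omega
    _ = 2 ^ (2 * Φ.F n + 1) := by rw [pow_succ]; ring
    _ ≤ 2 ^ (3 * Φ.F n + 5) := Nat.pow_le_pow_right (by norm_num) (by omega)

/-- `two_N_succ_le_FB` (plumbing). [cite: AroraBarak2009, §1.3 (polynomial-time arithmetic on binary numerals)] -/
theorem two_N_succ_le_FB (n : ℕ) : 2 * (Φ.N n + 1) ≤ Φ.FB n := by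
  have := Φ.N_lt n
  unfold FB Fb
  calc 2 * (Φ.N n + 1) ≤ 2 * 2 ^ Φ.F n := by omega
    _ = 2 ^ (Φ.F n + 1) := by rw [pow_succ]; ring
    _ ≤ 2 ^ (3 * Φ.F n + 5) := Nat.pow_le_pow_right (by norm_num) (by omega)

/-- `X_eq` (plumbing). [cite: AroraBarak2009, §1.3 (polynomial-time arithmetic on binary numerals)] -/
theorem X_eq (n : ℕ) : Φ.X n = 1 + (Φ.Lmid n + (Φ.N n + 1)) := rfl

/-- `size_two_N_le` (plumbing). [cite: AroraBarak2009, §1.3 (polynomial-time arithmetic on binary numerals)] -/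
theorem size_two_N_le (n : ℕ) : Nat.size (2 * Φ.N n) ≤ Φ.F n + 1 :=
  Nat.size_le.2 (by rw [pow_succ]; have := Φ.N_lt n; omega)

/-- `size_le_of_le_two_N` (plumbing). [cite: AroraBarak2009, §1.3 (polynomial-time arithmetic on binary numerals)] -/
theorem size_le_of_le_two_N {n j : ℕ} (h : j ≤ 2 * Φ.N n) : Nat.size j ≤ Φ.F n + 1 :=
  (Nat.size_le_size h).trans (Φ.size_two_N_le n)

/-- `T_lt_FB` (plumbing). [cite: AroraBarak2009, §1.3 (polynomial-time arithmetic on binary numerals)] -/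
theorem T_lt_FB (n : ℕ) : Φ.T n < Φ.FB n := by
  have h1 := Φ.T_le_F n
  have h2 : Φ.F n < 2 ^ Φ.F n := Nat.lt_two_pow_self
  unfold FB Fb
  calc Φ.T n ≤ Φ.F n := h1
    _ < 2 ^ Φ.F n := h2
    _ ≤ 2 ^ (3 * Φ.F n + 5) := Nat.pow_le_pow_right (by norm_num) (by omega)

/-- The parameter facts used by the axioms, in one conjunction (for `obtain`). [cite: AroraBarak2009, §1.3 (polynomial-time arithmetic on binary numerals)] -/
theorem param_facts (n : ℕ) :
    32 ≤ Φ.FB n ∧ 2 * Φ.X n ≤ Φ.FB n ∧ 2 * Φ.R n ≤ Φ.FB n ∧ 2 * (Φ.N n * Φ.N n) ≤ Φ.FB n ∧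
      2 * (Φ.N n + 1) ≤ Φ.FB n ∧ Φ.X n = 1 + (Φ.Lmid n + (Φ.N n + 1)) ∧ Φ.T n ≤ Φ.F n ∧ Φ.T n < Φ.FB n ∧
      Φ.Lreq n = 2 * n + 2 + 8 * (2 * (3 * Φ.F n + 5) + 2) :=
  ⟨Φ.FB_ge n, Φ.two_X_le_FB n, Φ.two_R_le_FB n, Φ.two_NN_le_FB n, Φ.two_N_succ_le_FB n, Φ.X_eq n, Φ.T_le_F n,
    Φ.T_lt_FB n, rfl⟩

end SuccIntMatrixFamily

/-! ### The vocabulary: scalar variables and flag combinators -/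

namespace KVC

open SuccCircuit

variable (Φ : SuccIntMatrixFamily)

/-- tag [folklore] -/ def vTag : AExp := .var 0
/-- sign part [folklore] -/ def vS : AExp := .var 1
/-- field 1 [folklore] -/ def v1 : AExp := .var 2
/-- field 2 [folklore] -/ def v2 : AExp := .var 3
/-- field 3 [folklore] -/ def v3 : AExp := .var 4
/-- field 4 [folklore] -/ def v4 : AExp := .var 5
/-- field 5 [folklore] -/ def v5 : AExp := .var 6
/-- field 6 [folklore] -/ def v6 : AExp := .var 7
/-- index n [folklore] -/ def vN0 : AExp := .var 8
/-- name length [folklore] -/ def vLen : AExp := .var 9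
/-- size of field i (i = 0..7) [folklore] -/ def vSz (i : ℕ) : AExp := .var (10 + i)
/-- rows [folklore] -/ def pR : AExp := .var 18
/-- columns [folklore] -/ def pN : AExp := .var 19
/-- entry width [folklore] -/ def pW0 : AExp := .var 20
/-- field width [folklore] -/ def pF : AExp := .var 21
/-- labels [folklore] -/ def pX : AExp := .var 22
/-- squarings [folklore] -/ def pT : AExp := .var 23
/-- internal labels [folklore] -/ def pLmid : AExp := .var 24
/-- select width [folklore] -/ def pWmux : AExp := .var 25
/-- required length [folklore] -/ def pLreq : AExp := .var 26
/-- bits per field [folklore] -/ def pFb : AExp := .var 27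
/-- field bound [folklore] -/ def pFB : AExp := .var 28
/-- the child index (child environments) [folklore] -/ def cK : AExp := .var 0

/-- conjunction of `0/1` flags [folklore] -/ def aand (a b : AExp) : AExp := .mul a b
/-- `a ≤ b` as a flag [folklore] -/ def ale (a b : AExp) : AExp := .lt a (.add b (.lit 1))
/-- `a < b` as a flag [folklore] -/ def alt (a b : AExp) : AExp := .lt a b
/-- `a = b` as a flag [folklore] -/ def aeq (a b : AExp) : AExp := .beq a b

/-- The zero tuple (tag `30`, in any environment). [folklore] -/
def zeroT : List AExp := [.lit 30, .lit 0, .lit 0, .lit 0, .lit 0, .lit 0, .lit 0, .lit 0]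

/-- The generic well-formedness: tag `≤ 30`, sign `≤ 1`, fields below the field bound, name long
enough, and `N ≥ 1`. [cite: KoiranPerifel2009VPSPACE, §3.2] -/
def wfGen : AExp :=
  aand (ale vTag (.lit 30)) (aand (ale vS (.lit 1)) (aand (alt v1 pFB) (aand (alt v2 pFB) (aand (alt v3 pFB)
    (aand (alt v4 pFB) (aand (alt v5 pFB) (aand (alt v6 pFB) (aand (ale pLreq vLen) (alt (.lit 0) pN)))))))))


/-! ### The gate vocabulary (generated from the gate table of MEMO-x5g7-KV20-M1-P6-circuit.md) -/

/-- Label decoding for the all-coefficients matrix: the case `κ ∈ {0: zero, 1: one, 3: +entry, 4: −entry}` of the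
entry `(x, y)` (`x = f1`, `y = f2`) of the reindexed `mvCharAdj` (labels: source `0`, internal `(ℓ,t,u) ↦ 1 + u + N t + N² ℓ`,
sinks `d ↦ 1 + Lmid + d`). [cite: MahajanVinay1999, §3.1 (p0006.txt:L11–47)] -/
def mKap : AExp :=
  (.cond (aeq v2 (.lit 0)) (.lit 0) (.cond (aeq v1 (.lit 0)) (.cond (aand (alt (.lit 0) v2) (ale v2 pLmid)) (.cond (aeq (.div (.sub v2 (.lit 1)) (.mul pN pN)) (.lit 0)) (.cond (alt (.emod (.sub v2 (.lit 1)) pN) (.emod (.div (.sub v2 (.lit 1)) pN) pN)) (.lit 3) (.cond (aeq (.emod (.sub v2 (.lit 1)) pN) (.emod (.div (.sub v2 (.lit 1)) pN) pN)) (.lit 4) (.lit 0))) (.lit 0)) (.cond (aeq (.sub v2 (.add (.lit 1) pLmid)) (.lit 0)) (.lit 1) (.lit 0))) (.cond (aand (alt (.lit 0) v1) (ale v1 pLmid)) (.cond (aand (alt (.lit 0) v2) (ale v2 pLmid)) (.cond (aeq (.div (.sub v2 (.lit 1)) (.mul pN pN)) (.add (.div (.sub v1 (.lit 1)) (.mul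 pN pN)) (.lit 1))) (.cond (aand (alt (.emod (.sub v1 (.lit 1)) pN) (.emod (.div (.sub v1 (.lit 1)) pN) pN)) (aeq (.emod (.div (.sub v2 (.lit 1)) pN) pN) (.emod (.div (.sub v1 (.lit 1)) pN) pN))) (.cond (alt (.emod (.sub v2 (.lit 1)) pN) (.emod (.div (.sub v2 (.lit 1)) pN) pN)) (.lit 3) (.cond (aeq (.emod (.sub v2 (.lit 1)) pN) (.emod (.div (.sub v2 (.lit 1)) pN) pN)) (.lit 4) (.lit 0))) (.cond (aand (aeq (.emod (.sub v1 (.lit 1)) pN) (.emod (.div (.sub v1 (.lit 1)) pN) pN)) (alt (.emod (.div (.sub v1 (.lit 1)) pN) pN) (.emod (.div (.sub v2 (.lit 1)) pN) pN))) (.cond (alt (.emod (.sub v2 (.lit 1)) pN) (.emod (.div (.sub v2 (.lit 1)) pN) pN)) (.lit 3) (.cond (aeq (.emod (.sub v2 (.lit 1)) pN) (.emod (.div (.sub v2 (.lit 1)) pN) pN)) (.lit 4) (.lit 0))) (.lit 0))) (.lit 0)) (.cond (aeq (.sub v2 (.add (.lit 1) pLmid)) pN) (.cond (aeq (.div (.sub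 v1 (.lit 1)) (.mul pN pN)) (.sub pN (.lit 2))) (.cond (alt (.emod (.sub v1 (.lit 1)) pN) (.emod (.div (.sub v1 (.lit 1)) pN) pN)) (.cond (aeq (.emod (.div (.sub v1 (.lit 1)) pN) pN) (.sub pN (.lit 1))) (.lit 4) (.lit 0)) (.cond (aeq (.emod (.sub v1 (.lit 1)) pN) (.emod (.div (.sub v1 (.lit 1)) pN) pN)) (.cond (alt (.emod (.div (.sub v1 (.lit 1)) pN) pN) (.sub pN (.lit 1))) (.lit 4) (.lit 0)) (.lit 0))) (.lit 0)) (.cond (aand (aeq (.add (.div (.sub v1 (.lit 1)) (.mul pN pN)) (.lit 1)) (.sub v2 (.add (.lit 1) pLmid))) (aeq (.emod (.sub v1 (.lit 1)) pN) (.emod (.div (.sub v1 (.lit 1)) pN) pN))) (.lit 1) (.lit 0)))) (.cond (aand (alt (.lit 0) v2) (ale v2 pLmid)) (.lit 0) (.cond (aeq (.sub v1 (.add (.lit 1) pLmid)) (.sub v2 (.add (.lit 1) pLmid))) (.lit 1) (.lit 0))))))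

/-- Label decoding: the row of the `AᵀA` entry carried by the matrix entry `(x, y)`. [cite: MahajanVinay1999, §3.1] -/
def mRow : AExp :=
  (.cond (aeq v1 (.lit 0)) (.emod (.div (.sub v2 (.lit 1)) pN) pN) (.cond (aand (alt (.lit 0) v2) (ale v2 pLmid)) (.cond (aand (alt (.emod (.sub v1 (.lit 1)) pN) (.emod (.div (.sub v1 (.lit 1)) pN) pN)) (aeq (.emod (.div (.sub v2 (.lit 1)) pN) pN) (.emod (.div (.sub v1 (.lit 1)) pN) pN))) (.emod (.sub v1 (.lit 1)) pN) (.emod (.div (.sub v2 (.lit 1)) pN) pN)) (.cond (alt (.emod (.sub v1 (.lit 1)) pN) (.emod (.div (.sub v1 (.lit 1)) pN) pN)) (.emod (.sub v1 (.lit 1)) pN) (.sub pN (.lit 1)))))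

/-- Label decoding: the column of the `AᵀA` entry carried by the matrix entry `(x, y)`. [cite: MahajanVinay1999, §3.1] -/
def mCol : AExp :=
  (.cond (aeq v1 (.lit 0)) (.emod (.sub v2 (.lit 1)) pN) (.cond (aand (alt (.lit 0) v2) (ale v2 pLmid)) (.emod (.sub v2 (.lit 1)) pN) (.sub pN (.lit 1))))

/-- `mKap` read in Lean. [cite: MahajanVinay1999, §3.1] -/
def mKapL (n x y : ℕ) : ℕ :=
  (if y = 0 then 0 else (if x = 0 then (if 0 < y ∧ (y ≤ (Φ.Lmid n)) then (if ((y - 1) / ((Φ.N n) * (Φ.N n))) = 0 then (if ((y - 1) % (Φ.N n)) < (((y - 1) / (Φ.N n)) % (Φ.N n)) then 3 else (if ((y - 1) % (Φ.N n)) = (((y - 1) / (Φ.N n)) % (Φ.N n)) then 4 else 0)) else 0) else (if (y - (1 + (Φ.Lmid n))) = 0 then 1 else 0)) else (if 0 < x ∧ (x ≤ (Φ.Lmid n)) then (if 0 < y ∧ (y ≤ (Φ.Lmid n)) then (if ((y - 1) / ((Φ.N n) * (Φ.N n))) = (((x - 1) / ((Φ.N n) * (Φ.N n))) + 1) then (if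 ((x - 1) % (Φ.N n)) < (((x - 1) / (Φ.N n)) % (Φ.N n)) ∧ ((((y - 1) / (Φ.N n)) % (Φ.N n)) = (((x - 1) / (Φ.N n)) % (Φ.N n))) then (if ((y - 1) % (Φ.N n)) < (((y - 1) / (Φ.N n)) % (Φ.N n)) then 3 else (if ((y - 1) % (Φ.N n)) = (((y - 1) / (Φ.N n)) % (Φ.N n)) then 4 else 0)) else (if ((x - 1) % (Φ.N n)) = (((x - 1) / (Φ.N n)) % (Φ.N n)) ∧ ((((x - 1) / (Φ.N n)) % (Φ.N n)) < (((y - 1) / (Φ.N n)) % (Φ.N n))) then (if ((y - 1) % (Φ.N n)) < (((y - 1) / (Φ.N n)) % (Φ.N n)) then 3 else (if ((y - 1) % (Φ.N n)) = (((y - 1) / (Φ.N n)) % (Φ.N n)) then 4 else 0)) else 0)) else 0) else (if (y - (1 + (Φ.Lmid n))) = (Φ.N n) then (if ((x - 1) / ((Φ.N n) * (Φ.N n))) = ((Φ.N n) - 2) then (if ((x - 1) % (Φ.N n)) < (((x - 1) / (Φ.N n)) % (Φ.N n)) then (if (((x - 1) / (Φ.N n)) % (Φ.N n)) = ((Φ.N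 n) - 1) then 4 else 0) else (if ((x - 1) % (Φ.N n)) = (((x - 1) / (Φ.N n)) % (Φ.N n)) then (if (((x - 1) / (Φ.N n)) % (Φ.N n)) < ((Φ.N n) - 1) then 4 else 0) else 0)) else 0) else (if (((x - 1) / ((Φ.N n) * (Φ.N n))) + 1) = (y - (1 + (Φ.Lmid n))) ∧ (((x - 1) % (Φ.N n)) = (((x - 1) / (Φ.N n)) % (Φ.N n))) then 1 else 0))) else (if 0 < y ∧ (y ≤ (Φ.Lmid n)) then 0 else (if (x - (1 + (Φ.Lmid n))) = (y - (1 + (Φ.Lmid n))) then 1 else 0)))))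

/-- `mRow` read in Lean. [cite: MahajanVinay1999, §3.1] -/
def mRowL (n x y : ℕ) : ℕ :=
  (if x = 0 then (((y - 1) / (Φ.N n)) % (Φ.N n)) else (if 0 < y ∧ (y ≤ (Φ.Lmid n)) then (if ((x - 1) % (Φ.N n)) < (((x - 1) / (Φ.N n)) % (Φ.N n)) ∧ ((((y - 1) / (Φ.N n)) % (Φ.N n)) = (((x - 1) / (Φ.N n)) % (Φ.N n))) then ((x - 1) % (Φ.N n)) else (((y - 1) / (Φ.N n)) % (Φ.N n))) else (if ((x - 1) % (Φ.N n)) < (((x - 1) / (Φ.N n)) % (Φ.N n)) then ((x - 1) % (Φ.N n)) else ((Φ.N n) - 1))))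

/-- `mCol` read in Lean. [cite: MahajanVinay1999, §3.1] -/
def mColL (n x y : ℕ) : ℕ :=
  (if x = 0 then ((y - 1) % (Φ.N n)) else (if 0 < y ∧ (y ≤ (Φ.Lmid n)) then ((y - 1) % (Φ.N n)) else ((Φ.N n) - 1)))

/-- Per-tag range conditions (as flags). [cite: KoiranPerifel2009VPSPACE, §3.2] -/
def wfT : ℕ → AExp
  | 0 => (.lit 1)
  | 1 => (aand (alt v1 pR) (alt v2 pN))
  | 2 => (aand (alt v1 pN) (alt v2 pN))
  | 3 => (aand (alt v1 pN) (aand (alt v2 pN) (alt v3 (.mul (.lit 2) pR))))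
  | 4 => (aand (alt v1 pX) (alt v2 pX))
  | 5 => (aand (ale v1 pT) (aand (alt v2 pX) (alt v3 pX)))
  | 6 => (aand (alt (.lit 0) v1) (aand (ale v1 pT) (aand (alt v2 pX) (aand (alt v3 pX) (alt v4 (.mul (.lit 2) pX))))))
  | 7 => (ale v1 (.mul (.lit 2) pN))
  | 8 => (aand (ale v1 (.mul (.lit 2) pN)) (aand (alt v2 pN) (alt v3 pN)))
  | 9 => (aand (alt (.lit 0) v1) (aand (ale v1 (.mul (.lit 2) pN)) (aand (alt v2 pN) (alt v3 pN))))
  | 10 => (aand (alt (.lit 0) v1) (aand (ale v1 (.mul (.lit 2) pN)) (aand (alt v2 pN) (aand (alt v3 pN) (alt v4 (.mul (.lit 2) pN))))))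
  | 11 => (aand (alt (.lit 0) v1) (aand (ale v1 (.mul (.lit 2) pN)) (aand (aeq (.emod v1 (.lit 2)) (.lit 1)) (aand (alt v2 pN) (aand (alt v3 pN) (alt v4 (.mul (.lit 2) pN)))))))
  | 12 => (ale v1 (.add pN (.lit 1)))
  | 13 => (alt v1 (.mul (.lit 2) (.add pN (.lit 1))))
  | 14 => (aand (ale v1 pN) (aand (ale v2 pN) (aand (alt v3 pN) (alt v4 pN))))
  | 15 => (aand (ale v1 pN) (aand (ale v2 pN) (aand (alt v3 pN) (aand (alt v4 pN) (alt v5 (.mul (.lit 2) (.add pN (.lit 1))))))))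
  | 16 => (aand (ale v1 pN) (aand (ale v2 pN) (aand (alt v3 pN) (alt v4 pN))))
  | 17 => (aand (ale v1 pN) (aand (ale v2 pN) (aand (alt v3 pN) (alt v4 pN))))
  | 18 => (aand (ale v1 pN) (aand (alt v2 pN) (alt v3 pN)))
  | 19 => (ale v1 pN)
  | 20 => (aand (ale v1 pN) (alt v2 (.mul (.lit 2) (.mul pN pN))))
  | 21 => (aand (alt v1 pN) (aand (alt v2 pN) (alt v3 pN)))
  | 22 => (aand (alt v1 pN) (aand (alt v2 pN) (alt v3 pN)))
  | 23 => (aand (alt v1 pN) (alt v2 pN))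
  | 24 => (alt v1 pN)
  | 25 => (aand (alt v1 pN) (alt v2 (.mul (.lit 2) pN)))
  | 26 => (ale v1 pN)
  | 27 => (aand (alt v1 pN) (alt v2 pN))
  | 28 => (aand (alt v1 pN) (alt v2 pN))
  | 29 => (alt v1 pN)
  | 30 => (.lit 1)
  | _ => (.lit 0)

/-- Per-tag kind (`1` sum, `2` product, `3` select, `0` constant). [cite: KoiranPerifel2009VPSPACE, §3.2] -/
def kindT : ℕ → AExp
  | 2 => (.lit 1)
  | 3 => (.lit 2)
  | 4 => (.lit 1)
  | 5 => (.lit 1)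
  | 6 => (.lit 2)
  | 7 => (.lit 1)
  | 8 => (.lit 1)
  | 9 => (.lit 1)
  | 10 => (.lit 2)
  | 11 => (.lit 2)
  | 12 => (.lit 1)
  | 13 => (.lit 2)
  | 14 => (.lit 1)
  | 15 => (.lit 2)
  | 16 => (.lit 3)
  | 17 => (.lit 3)
  | 18 => (.lit 1)
  | 19 => (.lit 1)
  | 20 => (.lit 2)
  | 21 => (.lit 3)
  | 22 => (.lit 3)
  | 23 => (.lit 1)
  | 24 => (.lit 1)
  | 25 => (.lit 2)
  | 26 => (.lit 1)
  | 27 => (.lit 3)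
  | 28 => (.lit 3)
  | 29 => (.lit 1)
  | _ => (.lit 0)

/-- Per-tag width (constants: number of bits; selects: bits compared). [cite: KoiranPerifel2009VPSPACE, §3.2] -/
def widthT : ℕ → AExp
  | 0 => (.lit 1)
  | 1 => pW0
  | 16 => pWmux
  | 17 => pWmux
  | 21 => pWmux
  | 22 => pWmux
  | 27 => pWmux
  | 28 => pWmux
  | 30 => (.lit 0)
  | _ => (.lit 0)

/-- Per-tag arity of sum gates. [cite: KoiranPerifel2009VPSPACE, §3.2] -/
def arityT : ℕ → AExp
  | 2 => (.mul (.lit 2) pR)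
  | 4 => (.cond (aeq mKap (.lit 1)) (.cond (aeq vS (.lit 0)) (.lit 1) (.lit 0)) (.cond (aeq mKap (.lit 3)) (.lit 1) (.cond (aeq mKap (.lit 4)) (.lit 1) (.lit 0))))
  | 5 => (.cond (aeq v1 (.lit 0)) (.lit 1) (.mul (.lit 2) pX))
  | 7 => (.cond (ale v1 pN) (.lit 1) (.lit 0))
  | 8 => (.cond (aeq v1 (.lit 0)) (.cond (aand (aeq v2 v3) (aeq vS (.lit 0))) (.lit 1) (.lit 0)) (.cond (aeq (.emod v1 (.lit 2)) (.lit 0)) (.lit 1) (.mul (.lit 2) pN)))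
  | 9 => (.mul (.lit 2) pN)
  | 12 => (.mul (.lit 2) v1)
  | 14 => (.mul (.lit 2) (.add pN (.lit 1)))
  | 18 => (.add pN (.lit 1))
  | 19 => (.mul (.lit 2) (.mul pN pN))
  | 23 => pN
  | 24 => (.mul (.lit 2) pN)
  | 26 => v1
  | 29 => pN
  | _ => (.lit 0)

/-- Per-tag depth. [cite: KoiranPerifel2009VPSPACE, §3.2] -/
def depthT : ℕ → AExp
  | 0 => (.lit 0)
  | 1 => (.lit 0)
  | 2 => (.lit 2)
  | 3 => (.lit 1)
  | 4 => (.lit 3)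
  | 5 => (.add (.mul (.lit 2) v1) (.lit 4))
  | 6 => (.add (.mul (.lit 2) v1) (.lit 3))
  | 7 => (.add (.mul (.lit 2) pT) (.lit 5))
  | 8 => (.add (.mul (.lit 4) (vSz 2)) (.lit 3))
  | 9 => (.add (.mul (.lit 4) (vSz 2)) (.lit 1))
  | 10 => (.mul (.lit 4) (vSz 2))
  | 11 => (.add (.mul (.lit 4) (vSz 2)) (.lit 2))
  | 12 => (.add (.mul (.lit 2) pT) (.lit 7))
  | 13 => (.add (.mul (.lit 2) pT) (.lit 6))
  | 14 => (.add (.mul (.lit 4) pF) (.lit 9))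
  | 15 => (.add (.mul (.lit 4) pF) (.lit 8))
  | 16 => (.add (.mul (.lit 4) pF) (.lit 11))
  | 17 => (.add (.mul (.lit 4) pF) (.lit 10))
  | 18 => (.add (.mul (.lit 4) pF) (.lit 12))
  | 19 => (.add (.mul (.lit 4) pF) (.lit 14))
  | 20 => (.add (.mul (.lit 4) pF) (.lit 13))
  | 21 => (.add (.mul (.lit 4) pF) (.lit 16))
  | 22 => (.add (.mul (.lit 4) pF) (.lit 15))
  | 23 => (.add (.mul (.lit 4) pF) (.lit 17))
  | 24 => (.add (.mul (.lit 4) pF) (.lit 19))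
  | 25 => (.add (.mul (.lit 4) pF) (.lit 18))
  | 26 => (.add (.mul (.lit 4) pF) (.lit 20))
  | 27 => (.add (.mul (.lit 4) pF) (.lit 21))
  | 28 => (.add (.mul (.lit 4) pF) (.lit 20))
  | 29 => (.add (.mul (.lit 4) pF) (.lit 22))
  | 30 => (.lit 0)
  | _ => (.lit 0)

/-- Per-tag children tuples, as expressions over the child environment (`cK` = the child index,
`bump e` = the parent's `e`). [cite: KoiranPerifel2009VPSPACE, §3.2] -/
def chT : ℕ → List AExp
  | 2 => [(.lit 3), (bump vS), (bump v1), (bump v2), cK, (.lit 0), (.lit 0), (.lit 0)]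
  | 3 => [(.cond (aeq cK (.lit 0)) (.lit 1) (.lit 1)), (.cond (aeq cK (.lit 0)) (.emod (bump v3) (.lit 2)) (.emod (.add (.emod (bump v3) (.lit 2)) (bump vS)) (.lit 2))), (.cond (aeq cK (.lit 0)) (.div (bump v3) (.lit 2)) (.div (bump v3) (.lit 2))), (.cond (aeq cK (.lit 0)) (bump v1) (bump v2)), (.cond (aeq cK (.lit 0)) (.lit 0) (.lit 0)), (.cond (aeq cK (.lit 0)) (.lit 0) (.lit 0)), (.cond (aeq cK (.lit 0)) (.lit 0) (.lit 0)), (.cond (aeq cK (.lit 0)) (.lit 0) (.lit 0))]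
  | 4 => [(.cond (aeq (bump mKap) (.lit 1)) (.lit 0) (.lit 2)), (.cond (aeq (bump mKap) (.lit 1)) (.lit 0) (.cond (aeq (bump mKap) (.lit 3)) (bump vS) (.sub (.lit 1) (bump vS)))), (.cond (aeq (bump mKap) (.lit 1)) (.lit 0) (bump mRow)), (.cond (aeq (bump mKap) (.lit 1)) (.lit 0) (bump mCol)), (.lit 0), (.lit 0), (.lit 0), (.lit 0)]
  | 5 => [(.cond (aeq (bump v1) (.lit 0)) (.lit 4) (.lit 6)), (.cond (aeq (bump v1) (.lit 0)) (bump vS) (bump vS)), (.cond (aeq (bump v1) (.lit 0)) (bump v2) (bump v1)), (.cond (aeq (bump v1) (.lit 0)) (bump v3) (bump v2)), (.cond (aeq (bump v1) (.lit 0)) (.lit 0) (bump v3)), (.cond (aeq (bump v1) (.lit 0)) (.lit 0) cK), (.cond (aeq (bump v1) (.lit 0)) (.lit 0) (.lit 0)), (.cond (aeq (bump v1) (.lit 0)) (.lit 0) (.lit 0))]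
  | 6 => [(.cond (aeq cK (.lit 0)) (.lit 5) (.lit 5)), (.cond (aeq cK (.lit 0)) (.emod (bump v4) (.lit 2)) (.emod (.add (.emod (bump v4) (.lit 2)) (bump vS)) (.lit 2))), (.cond (aeq cK (.lit 0)) (.sub (bump v1) (.lit 1)) (.sub (bump v1) (.lit 1))), (.cond (aeq cK (.lit 0)) (bump v2) (.div (bump v4) (.lit 2))), (.cond (aeq cK (.lit 0)) (.div (bump v4) (.lit 2)) (bump v3)), (.cond (aeq cK (.lit 0)) (.lit 0) (.lit 0)), (.cond (aeq cK (.lit 0)) (.lit 0) (.lit 0)), (.cond (aeq cK (.lit 0)) (.lit 0) (.lit 0))]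
  | 7 => [(.lit 5), (bump vS), (bump pT), (.lit 0), (.add (.add (.lit 1) (bump pLmid)) (.sub (bump pN) (bump v1))), (.lit 0), (.lit 0), (.lit 0)]
  | 8 => [(.cond (aeq (bump v1) (.lit 0)) (.lit 0) (.cond (aeq (.emod (bump v1) (.lit 2)) (.lit 0)) (.lit 9) (.lit 11))), (.cond (aeq (bump v1) (.lit 0)) (.lit 0) (.cond (aeq (.emod (bump v1) (.lit 2)) (.lit 0)) (bump vS) (bump vS))), (.cond (aeq (bump v1) (.lit 0)) (.lit 0) (.cond (aeq (.emod (bump v1) (.lit 2)) (.lit 0)) (bump v1) (bump v1))), (.cond (aeq (bump v1) (.lit 0)) (.lit 0) (.cond (aeq (.emod (bump v1) (.lit 2)) (.lit 0)) (bump v2) (bump v2))), (.cond (aeq (bump v1) (.lit 0)) (.lit 0) (.cond (aeq (.emod (bump v1) (.lit 2)) (.lit 0)) (bump v3) (bump v3))), (.cond (aeq (bump v1) (.lit 0)) (.lit 0) (.cond (aeq (.emod (bump v1) (.lit 2)) (.lit 0)) (.lit 0) cK)), (.cond (aeq (bump v1) (.lit 0)) (.lit 0) (.cond (aeq (.emod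 (bump v1) (.lit 2)) (.lit 0)) (.lit 0) (.lit 0))), (.cond (aeq (bump v1) (.lit 0)) (.lit 0) (.cond (aeq (.emod (bump v1) (.lit 2)) (.lit 0)) (.lit 0) (.lit 0)))]
  | 9 => [(.lit 10), (bump vS), (bump v1), (bump v2), (bump v3), cK, (.lit 0), (.lit 0)]
  | 10 => [(.cond (aeq cK (.lit 0)) (.lit 8) (.lit 8)), (.cond (aeq cK (.lit 0)) (.emod (bump v4) (.lit 2)) (.emod (.add (.emod (bump v4) (.lit 2)) (bump vS)) (.lit 2))), (.cond (aeq cK (.lit 0)) (.div (bump v1) (.lit 2)) (.div (bump v1) (.lit 2))), (.cond (aeq cK (.lit 0)) (bump v2) (.div (bump v4) (.lit 2))), (.cond (aeq cK (.lit 0)) (.div (bump v4) (.lit 2)) (bump v3)), (.cond (aeq cK (.lit 0)) (.lit 0) (.lit 0)), (.cond (aeq cK (.lit 0)) (.lit 0) (.lit 0)), (.cond (aeq cK (.lit 0)) (.lit 0) (.lit 0))]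
  | 11 => [(.cond (aeq cK (.lit 0)) (.lit 9) (.lit 2)), (.cond (aeq cK (.lit 0)) (.emod (bump v4) (.lit 2)) (.emod (.add (.emod (bump v4) (.lit 2)) (bump vS)) (.lit 2))), (.cond (aeq cK (.lit 0)) (bump v1) (.div (bump v4) (.lit 2))), (.cond (aeq cK (.lit 0)) (bump v2) (bump v3)), (.cond (aeq cK (.lit 0)) (.div (bump v4) (.lit 2)) (.lit 0)), (.cond (aeq cK (.lit 0)) (.lit 0) (.lit 0)), (.cond (aeq cK (.lit 0)) (.lit 0) (.lit 0)), (.cond (aeq cK (.lit 0)) (.lit 0) (.lit 0))]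
  | 12 => [(.lit 13), (bump vS), cK, (.lit 0), (.lit 0), (.lit 0), (.lit 0), (.lit 0)]
  | 13 => [(.cond (aeq cK (.lit 0)) (.lit 7) (.lit 7)), (.cond (aeq cK (.lit 0)) (.emod (bump v1) (.lit 2)) (.emod (.add (.emod (bump v1) (.lit 2)) (bump vS)) (.lit 2))), (.cond (aeq cK (.lit 0)) (.div (bump v1) (.lit 2)) (.div (bump v1) (.lit 2))), (.cond (aeq cK (.lit 0)) (.lit 0) (.lit 0)), (.cond (aeq cK (.lit 0)) (.lit 0) (.lit 0)), (.cond (aeq cK (.lit 0)) (.lit 0) (.lit 0)), (.cond (aeq cK (.lit 0)) (.lit 0) (.lit 0)), (.cond (aeq cK (.lit 0)) (.lit 0) (.lit 0))]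
  | 14 => [(.lit 15), (bump vS), (bump v1), (bump v2), (bump v3), (bump v4), cK, (.lit 0)]
  | 15 => [(.cond (aeq cK (.lit 0)) (.lit 7) (.lit 8)), (.cond (aeq cK (.lit 0)) (.emod (bump v5) (.lit 2)) (.emod (.add (.emod (bump v5) (.lit 2)) (bump vS)) (.lit 2))), (.cond (aeq cK (.lit 0)) (.add (.div (bump v5) (.lit 2)) (bump v1)) (.add (.div (bump v5) (.lit 2)) (bump v2))), (.cond (aeq cK (.lit 0)) (.lit 0) (bump v3)), (.cond (aeq cK (.lit 0)) (.lit 0) (bump v4)), (.cond (aeq cK (.lit 0)) (.lit 0) (.lit 0)), (.cond (aeq cK (.lit 0)) (.lit 0) (.lit 0)), (.cond (aeq cK (.lit 0)) (.lit 0) (.lit 0))]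
  | 16 => [(.cond (aeq cK (.lit 0)) (.lit 12) (.cond (aeq cK (.lit 1)) (.lit 12) (.cond (aeq cK (.lit 2)) (.lit 17) (.lit 30)))), (.cond (aeq cK (.lit 0)) (.lit 0) (.cond (aeq cK (.lit 1)) (.lit 1) (.cond (aeq cK (.lit 2)) (bump vS) (.lit 0)))), (.cond (aeq cK (.lit 0)) (bump v1) (.cond (aeq cK (.lit 1)) (bump v1) (.cond (aeq cK (.lit 2)) (bump v1) (.lit 0)))), (.cond (aeq cK (.lit 0)) (.lit 0) (.cond (aeq cK (.lit 1)) (.lit 0) (.cond (aeq cK (.lit 2)) (bump v2) (.lit 0)))), (.cond (aeq cK (.lit 0)) (.lit 0) (.cond (aeq cK (.lit 1)) (.lit 0) (.cond (aeq cK (.lit 2)) (bump v3) (.lit 0)))), (.cond (aeq cK (.lit 0)) (.lit 0) (.cond (aeq cK (.lit 1)) (.lit 0) (.cond (aeq cK (.lit 2)) (bump v4) (.lit 0)))), (.cond (aeq cK (.lit 0)) (.lit 0) (.cond (aeq cK (.lit 1)) (.lit 0) (.cond (aeq cK (.lit 2)) (.lit 0) (.lit 0)))), (.cond (aeq cK (.lit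 0)) (.lit 0) (.cond (aeq cK (.lit 1)) (.lit 0) (.cond (aeq cK (.lit 2)) (.lit 0) (.lit 0))))]
  | 17 => [(.cond (aeq cK (.lit 0)) (.lit 7) (.cond (aeq cK (.lit 1)) (.lit 7) (.cond (aeq cK (.lit 2)) (.lit 30) (.lit 14)))), (.cond (aeq cK (.lit 0)) (.lit 0) (.cond (aeq cK (.lit 1)) (.lit 1) (.cond (aeq cK (.lit 2)) (.lit 0) (bump vS)))), (.cond (aeq cK (.lit 0)) (bump v1) (.cond (aeq cK (.lit 1)) (bump v1) (.cond (aeq cK (.lit 2)) (.lit 0) (bump v1)))), (.cond (aeq cK (.lit 0)) (.lit 0) (.cond (aeq cK (.lit 1)) (.lit 0) (.cond (aeq cK (.lit 2)) (.lit 0) (bump v2)))), (.cond (aeq cK (.lit 0)) (.lit 0) (.cond (aeq cK (.lit 1)) (.lit 0) (.cond (aeq cK (.lit 2)) (.lit 0) (bump v3)))), (.cond (aeq cK (.lit 0)) (.lit 0) (.cond (aeq cK (.lit 1)) (.lit 0) (.cond (aeq cK (.lit 2)) (.lit 0) (bump v4)))), (.cond (aeq cK (.lit 0)) (.lit 0)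 (.cond (aeq cK (.lit 1)) (.lit 0) (.cond (aeq cK (.lit 2)) (.lit 0) (.lit 0)))), (.cond (aeq cK (.lit 0)) (.lit 0) (.cond (aeq cK (.lit 1)) (.lit 0) (.cond (aeq cK (.lit 2)) (.lit 0) (.lit 0))))]
  | 18 => [(.lit 16), (bump vS), cK, (bump v1), (bump v2), (bump v3), (.lit 0), (.lit 0)]
  | 19 => [(.lit 20), (bump vS), (bump v1), cK, (.lit 0), (.lit 0), (.lit 0), (.lit 0)]
  | 20 => [(.cond (aeq cK (.lit 0)) (.lit 18) (.lit 18)), (.cond (aeq cK (.lit 0)) (.emod (bump v2) (.lit 2)) (.emod (.add (.emod (bump v2) (.lit 2)) (bump vS)) (.lit 2))), (.cond (aeq cK (.lit 0)) (bump v1) (bump v1)), (.cond (aeq cK (.lit 0)) (.div (.div (bump v2) (.lit 2)) (bump pN)) (.div (.div (bump v2) (.lit 2)) (bump pN))), (.cond (aeq cK (.lit 0)) (.emod (.div (bump v2) (.lit 2)) (bump pN)) (.emod (.div (bump v2) (.lit 2)) (bump pN))), (.cond (aeq cK (.lit 0)) (.lit 0) (.lit 0)), (.cond (aeq cK (.lit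 0)) (.lit 0) (.lit 0)), (.cond (aeq cK (.lit 0)) (.lit 0) (.lit 0))]
  | 21 => [(.cond (aeq cK (.lit 0)) (.lit 19) (.cond (aeq cK (.lit 1)) (.lit 19) (.cond (aeq cK (.lit 2)) (.lit 22) (.lit 30)))), (.cond (aeq cK (.lit 0)) (.lit 0) (.cond (aeq cK (.lit 1)) (.lit 1) (.cond (aeq cK (.lit 2)) (bump vS) (.lit 0)))), (.cond (aeq cK (.lit 0)) (.add (bump v1) (.lit 1)) (.cond (aeq cK (.lit 1)) (.add (bump v1) (.lit 1)) (.cond (aeq cK (.lit 2)) (bump v1) (.lit 0)))), (.cond (aeq cK (.lit 0)) (.lit 0) (.cond (aeq cK (.lit 1)) (.lit 0) (.cond (aeq cK (.lit 2)) (bump v2) (.lit 0)))), (.cond (aeq cK (.lit 0)) (.lit 0) (.cond (aeq cK (.lit 1)) (.lit 0) (.cond (aeq cK (.lit 2)) (bump v3) (.lit 0)))), (.cond (aeq cK (.lit 0)) (.lit 0) (.cond (aeq cK (.lit 1)) (.lit 0) (.cond (aeq cK (.lit 2)) (.lit 0) (.lit 0)))), (.cond (aeq cK (.lit 0)) (.lit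 0) (.cond (aeq cK (.lit 1)) (.lit 0) (.cond (aeq cK (.lit 2)) (.lit 0) (.lit 0)))), (.cond (aeq cK (.lit 0)) (.lit 0) (.cond (aeq cK (.lit 1)) (.lit 0) (.cond (aeq cK (.lit 2)) (.lit 0) (.lit 0))))]
  | 22 => [(.cond (aeq cK (.lit 0)) (.lit 19) (.cond (aeq cK (.lit 1)) (.lit 19) (.cond (aeq cK (.lit 2)) (.lit 30) (.lit 18)))), (.cond (aeq cK (.lit 0)) (.lit 0) (.cond (aeq cK (.lit 1)) (.lit 1) (.cond (aeq cK (.lit 2)) (.lit 0) (bump vS)))), (.cond (aeq cK (.lit 0)) (bump v1) (.cond (aeq cK (.lit 1)) (bump v1) (.cond (aeq cK (.lit 2)) (.lit 0) (bump v1)))), (.cond (aeq cK (.lit 0)) (.lit 0) (.cond (aeq cK (.lit 1)) (.lit 0) (.cond (aeq cK (.lit 2)) (.lit 0) (bump v2)))), (.cond (aeq cK (.lit 0)) (.lit 0) (.cond (aeq cK (.lit 1)) (.lit 0) (.cond (aeq cK (.lit 2)) (.lit 0) (bump v3)))), (.cond (aeq cK (.lit 0)) (.lit 0) (.cond (aeq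 cK (.lit 1)) (.lit 0) (.cond (aeq cK (.lit 2)) (.lit 0) (.lit 0)))), (.cond (aeq cK (.lit 0)) (.lit 0) (.cond (aeq cK (.lit 1)) (.lit 0) (.cond (aeq cK (.lit 2)) (.lit 0) (.lit 0)))), (.cond (aeq cK (.lit 0)) (.lit 0) (.cond (aeq cK (.lit 1)) (.lit 0) (.cond (aeq cK (.lit 2)) (.lit 0) (.lit 0))))]
  | 23 => [(.lit 21), (bump vS), cK, (bump v1), (bump v2), (.lit 0), (.lit 0), (.lit 0)]
  | 24 => [(.lit 25), (bump vS), (bump v1), cK, (.lit 0), (.lit 0), (.lit 0), (.lit 0)]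
  | 25 => [(.cond (aeq cK (.lit 0)) (.lit 23) (.lit 23)), (.cond (aeq cK (.lit 0)) (.emod (bump v2) (.lit 2)) (.emod (.add (.emod (bump v2) (.lit 2)) (bump vS)) (.lit 2))), (.cond (aeq cK (.lit 0)) (.div (bump v2) (.lit 2)) (.div (bump v2) (.lit 2))), (.cond (aeq cK (.lit 0)) (bump v1) (bump v1)), (.cond (aeq cK (.lit 0)) (.lit 0) (.lit 0)), (.cond (aeq cK (.lit 0)) (.lit 0) (.lit 0)), (.cond (aeq cK (.lit 0)) (.lit 0) (.lit 0)), (.cond (aeq cK (.lit 0)) (.lit 0) (.lit 0))]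
  | 26 => [(.lit 24), (bump vS), cK, (.lit 0), (.lit 0), (.lit 0), (.lit 0), (.lit 0)]
  | 27 => [(.cond (aeq cK (.lit 0)) (.lit 26) (.cond (aeq cK (.lit 1)) (.lit 26) (.cond (aeq cK (.lit 2)) (.lit 28) (.lit 30)))), (.cond (aeq cK (.lit 0)) (.lit 0) (.cond (aeq cK (.lit 1)) (.lit 1) (.cond (aeq cK (.lit 2)) (bump vS) (.lit 0)))), (.cond (aeq cK (.lit 0)) (bump v1) (.cond (aeq cK (.lit 1)) (bump v1) (.cond (aeq cK (.lit 2)) (bump v1) (.lit 0)))), (.cond (aeq cK (.lit 0)) (.lit 0) (.cond (aeq cK (.lit 1)) (.lit 0) (.cond (aeq cK (.lit 2)) (bump v2) (.lit 0)))), (.cond (aeq cK (.lit 0)) (.lit 0) (.cond (aeq cK (.lit 1)) (.lit 0) (.cond (aeq cK (.lit 2)) (.lit 0) (.lit 0)))), (.cond (aeq cK (.lit 0)) (.lit 0) (.cond (aeq cK (.lit 1)) (.lit 0) (.cond (aeq cK (.lit 2)) (.lit 0) (.lit 0)))), (.cond (aeq cK (.lit 0)) (.lit 0) (.cond (aeq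 cK (.lit 1)) (.lit 0) (.cond (aeq cK (.lit 2)) (.lit 0) (.lit 0)))), (.cond (aeq cK (.lit 0)) (.lit 0) (.cond (aeq cK (.lit 1)) (.lit 0) (.cond (aeq cK (.lit 2)) (.lit 0) (.lit 0))))]
  | 28 => [(.cond (aeq cK (.lit 0)) (.lit 24) (.cond (aeq cK (.lit 1)) (.lit 24) (.cond (aeq cK (.lit 2)) (.lit 30) (.lit 23)))), (.cond (aeq cK (.lit 0)) (.lit 0) (.cond (aeq cK (.lit 1)) (.lit 1) (.cond (aeq cK (.lit 2)) (.lit 0) (bump vS)))), (.cond (aeq cK (.lit 0)) (bump v1) (.cond (aeq cK (.lit 1)) (bump v1) (.cond (aeq cK (.lit 2)) (.lit 0) (bump v2)))), (.cond (aeq cK (.lit 0)) (.lit 0) (.cond (aeq cK (.lit 1)) (.lit 0) (.cond (aeq cK (.lit 2)) (.lit 0) (bump v1)))), (.cond (aeq cK (.lit 0)) (.lit 0) (.cond (aeq cK (.lit 1)) (.lit 0) (.cond (aeq cK (.lit 2)) (.lit 0) (.lit 0)))), (.cond (aeq cK (.lit 0)) (.lit 0) (.cond (aeq cK (.lit 1))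 (.lit 0) (.cond (aeq cK (.lit 2)) (.lit 0) (.lit 0)))), (.cond (aeq cK (.lit 0)) (.lit 0) (.cond (aeq cK (.lit 1)) (.lit 0) (.cond (aeq cK (.lit 2)) (.lit 0) (.lit 0)))), (.cond (aeq cK (.lit 0)) (.lit 0) (.cond (aeq cK (.lit 1)) (.lit 0) (.cond (aeq cK (.lit 2)) (.lit 0) (.lit 0))))]
  | 29 => [(.lit 27), (bump vS), cK, (bump v1), (.lit 0), (.lit 0), (.lit 0), (.lit 0)]
  | _ => zeroT

/-- Dispatch on the tag (base environment). [cite: KoiranPerifel2009VPSPACE, §3.2] -/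
def bytag (f : ℕ → AExp) : AExp :=
  (.cond (aeq vTag (.lit 0)) (f 0) (.cond (aeq vTag (.lit 1)) (f 1) (.cond (aeq vTag (.lit 2)) (f 2) (.cond (aeq vTag (.lit 3)) (f 3) (.cond (aeq vTag (.lit 4)) (f 4) (.cond (aeq vTag (.lit 5)) (f 5) (.cond (aeq vTag (.lit 6)) (f 6) (.cond (aeq vTag (.lit 7)) (f 7) (.cond (aeq vTag (.lit 8)) (f 8) (.cond (aeq vTag (.lit 9)) (f 9) (.cond (aeq vTag (.lit 10)) (f 10) (.cond (aeq vTag (.lit 11)) (f 11) (.cond (aeq vTag (.lit 12)) (f 12) (.cond (aeq vTag (.lit 13)) (f 13) (.cond (aeq vTag (.lit 14)) (f 14) (.cond (aeq vTag (.lit 15)) (f 15) (.cond (aeq vTag (.lit 16)) (f 16) (.cond (aeq vTag (.lit 17)) (f 17) (.cond (aeq vTag (.lit 18)) (f 18) (.cond (aeq vTag (.lit 19)) (f 19) (.cond (aeq vTag (.lit 20)) (f 20) (.cond (aeq vTag (.lit 21)) (f 21) (.cond (aeq vTag (.lit 22)) (f 22) (.cond (aeq vTag (.lit 23)) (f 23)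 (.cond (aeq vTag (.lit 24)) (f 24) (.cond (aeq vTag (.lit 25)) (f 25) (.cond (aeq vTag (.lit 26)) (f 26) (.cond (aeq vTag (.lit 27)) (f 27) (.cond (aeq vTag (.lit 28)) (f 28) (.cond (aeq vTag (.lit 29)) (f 29) (.cond (aeq vTag (.lit 30)) (f 30) (.lit 0))))))))))))))))))))))))))))))))

/-- Dispatch on the tag (child environment). [cite: KoiranPerifel2009VPSPACE, §3.2] -/
def bytagK (f : ℕ → AExp) : AExp :=
  (.cond (aeq (bump vTag) (.lit 0)) (f 0) (.cond (aeq (bump vTag) (.lit 1)) (f 1) (.cond (aeq (bump vTag) (.lit 2)) (f 2) (.cond (aeq (bump vTag) (.lit 3)) (f 3) (.cond (aeq (bump vTag) (.lit 4)) (f 4) (.cond (aeq (bump vTag) (.lit 5)) (f 5) (.cond (aeq (bump vTag) (.lit 6)) (f 6) (.cond (aeq (bump vTag) (.lit 7)) (f 7) (.cond (aeq (bump vTag) (.lit 8)) (f 8) (.cond (aeq (bump vTag) (.lit 9)) (f 9) (.cond (aeq (bump vTag) (.lit 10)) (f 10) (.cond (aeq (bump vTag) (.lit 11)) (f 11) (.cond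 (aeq (bump vTag) (.lit 12)) (f 12) (.cond (aeq (bump vTag) (.lit 13)) (f 13) (.cond (aeq (bump vTag) (.lit 14)) (f 14) (.cond (aeq (bump vTag) (.lit 15)) (f 15) (.cond (aeq (bump vTag) (.lit 16)) (f 16) (.cond (aeq (bump vTag) (.lit 17)) (f 17) (.cond (aeq (bump vTag) (.lit 18)) (f 18) (.cond (aeq (bump vTag) (.lit 19)) (f 19) (.cond (aeq (bump vTag) (.lit 20)) (f 20) (.cond (aeq (bump vTag) (.lit 21)) (f 21) (.cond (aeq (bump vTag) (.lit 22)) (f 22) (.cond (aeq (bump vTag) (.lit 23)) (f 23) (.cond (aeq (bump vTag) (.lit 24)) (f 24) (.cond (aeq (bump vTag) (.lit 25)) (f 25) (.cond (aeq (bump vTag) (.lit 26)) (f 26) (.cond (aeq (bump vTag) (.lit 27)) (f 27) (.cond (aeq (bump vTag) (.lit 28)) (f 28) (.cond (aeq (bump vTag) (.lit 29)) (f 29) (.cond (aeq (bump vTag) (.lit 30)) (f 30) (.lit 0))))))))))))))))))))))))))))))))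

/-- The well-formedness flag: generic conditions and the per-tag ranges. [cite: KoiranPerifel2009VPSPACE, §3.2] -/
def wf : AExp := aand wfGen (bytag wfT)

/-- The kind of a gate (names that are not well formed are constants). [cite: KoiranPerifel2009VPSPACE, §3.2] -/
def kindX : AExp := .cond wf (bytag kindT) (.lit 0)

/-- The width of a gate. [cite: KoiranPerifel2009VPSPACE, §3.2] -/
def widthX : AExp := .cond wf (bytag widthT) (.lit 0)

/-- The arity of a (sum) gate. [cite: KoiranPerifel2009VPSPACE, §3.2] -/
def arityX : AExp := .cond wf (bytag arityT) (.lit 0)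

/-- The depth of a gate. [cite: KoiranPerifel2009VPSPACE, §3.2] -/
def depthX : AExp := .cond wf (bytag depthT) (.lit 0)

/-- The children of a gate: component `i` of the tag's child tuple. [cite: KoiranPerifel2009VPSPACE, §3.2] -/
def childX : List AExp :=
  [bytagK fun c => (chT c).getD 0 (.lit 0), bytagK fun c => (chT c).getD 1 (.lit 0),
   bytagK fun c => (chT c).getD 2 (.lit 0), bytagK fun c => (chT c).getD 3 (.lit 0),
   bytagK fun c => (chT c).getD 4 (.lit 0), bytagK fun c => (chT c).getD 5 (.lit 0),
   bytagK fun c => (chT c).getD 6 (.lit 0), bytagK fun c => (chT c).getD 7 (.lit 0)]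

/-- The per-tag range conditions, read in Lean. [cite: KoiranPerifel2009VPSPACE, §3.2] -/
def WFt (n : ℕ) : ℕ → ℕ → ℕ → ℕ → ℕ → ℕ → ℕ → ℕ → Prop
  | 0, _, _, _, _, _, _, _ => True
  | 1, _, f1, f2, _, _, _, _ => f1 < (Φ.R n) ∧ (f2 < (Φ.N n))
  | 2, _, f1, f2, _, _, _, _ => f1 < (Φ.N n) ∧ (f2 < (Φ.N n))
  | 3, _, f1, f2, f3, _, _, _ => f1 < (Φ.N n) ∧ (f2 < (Φ.N n) ∧ (f3 < (2 * (Φ.R n))))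
  | 4, _, f1, f2, _, _, _, _ => f1 < (Φ.X n) ∧ (f2 < (Φ.X n))
  | 5, _, f1, f2, f3, _, _, _ => f1 ≤ (Φ.T n) ∧ (f2 < (Φ.X n) ∧ (f3 < (Φ.X n)))
  | 6, _, f1, f2, f3, f4, _, _ => 0 < f1 ∧ (f1 ≤ (Φ.T n) ∧ (f2 < (Φ.X n) ∧ (f3 < (Φ.X n) ∧ (f4 < (2 * (Φ.X n))))))
  | 7, _, f1, _, _, _, _, _ => f1 ≤ (2 * (Φ.N n))
  | 8, _, f1, f2, f3, _, _, _ => f1 ≤ (2 * (Φ.N n)) ∧ (f2 < (Φ.N n) ∧ (f3 < (Φ.N n)))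
  | 9, _, f1, f2, f3, _, _, _ => 0 < f1 ∧ (f1 ≤ (2 * (Φ.N n)) ∧ (f2 < (Φ.N n) ∧ (f3 < (Φ.N n))))
  | 10, _, f1, f2, f3, f4, _, _ => 0 < f1 ∧ (f1 ≤ (2 * (Φ.N n)) ∧ (f2 < (Φ.N n) ∧ (f3 < (Φ.N n) ∧ (f4 < (2 * (Φ.N n))))))
  | 11, _, f1, f2, f3, f4, _, _ => 0 < f1 ∧ (f1 ≤ (2 * (Φ.N n)) ∧ ((f1 % 2) = 1 ∧ (f2 < (Φ.N n) ∧ (f3 < (Φ.N n) ∧ (f4 < (2 * (Φ.N n)))))))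
  | 12, _, f1, _, _, _, _, _ => f1 ≤ ((Φ.N n) + 1)
  | 13, _, f1, _, _, _, _, _ => f1 < (2 * ((Φ.N n) + 1))
  | 14, _, f1, f2, f3, f4, _, _ => f1 ≤ (Φ.N n) ∧ (f2 ≤ (Φ.N n) ∧ (f3 < (Φ.N n) ∧ (f4 < (Φ.N n))))
  | 15, _, f1, f2, f3, f4, f5, _ => f1 ≤ (Φ.N n) ∧ (f2 ≤ (Φ.N n) ∧ (f3 < (Φ.N n) ∧ (f4 < (Φ.N n) ∧ (f5 < (2 * ((Φ.N n) + 1))))))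
  | 16, _, f1, f2, f3, f4, _, _ => f1 ≤ (Φ.N n) ∧ (f2 ≤ (Φ.N n) ∧ (f3 < (Φ.N n) ∧ (f4 < (Φ.N n))))
  | 17, _, f1, f2, f3, f4, _, _ => f1 ≤ (Φ.N n) ∧ (f2 ≤ (Φ.N n) ∧ (f3 < (Φ.N n) ∧ (f4 < (Φ.N n))))
  | 18, _, f1, f2, f3, _, _, _ => f1 ≤ (Φ.N n) ∧ (f2 < (Φ.N n) ∧ (f3 < (Φ.N n)))
  | 19, _, f1, _, _, _, _, _ => f1 ≤ (Φ.N n)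
  | 20, _, f1, f2, _, _, _, _ => f1 ≤ (Φ.N n) ∧ (f2 < (2 * ((Φ.N n) * (Φ.N n))))
  | 21, _, f1, f2, f3, _, _, _ => f1 < (Φ.N n) ∧ (f2 < (Φ.N n) ∧ (f3 < (Φ.N n)))
  | 22, _, f1, f2, f3, _, _, _ => f1 < (Φ.N n) ∧ (f2 < (Φ.N n) ∧ (f3 < (Φ.N n)))
  | 23, _, f1, f2, _, _, _, _ => f1 < (Φ.N n) ∧ (f2 < (Φ.N n))
  | 24, _, f1, _, _, _, _, _ => f1 < (Φ.N n)
  | 25, _, f1, f2, _, _, _, _ => f1 < (Φ.N n) ∧ (f2 < (2 * (Φ.N n)))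
  | 26, _, f1, _, _, _, _, _ => f1 ≤ (Φ.N n)
  | 27, _, f1, f2, _, _, _, _ => f1 < (Φ.N n) ∧ (f2 < (Φ.N n))
  | 28, _, f1, f2, _, _, _, _ => f1 < (Φ.N n) ∧ (f2 < (Φ.N n))
  | 29, _, f1, _, _, _, _, _ => f1 < (Φ.N n)
  | 30, _, _, _, _, _, _, _ => True
  | _, _, _, _, _, _, _, _ => False


/-! ### Evaluation micro-lemmas: flags -/

/-- The `0/1` flag of a proposition. [folklore] -/
def flagOf (p : Prop) [Decidable p] : ℕ := if p then 1 else 0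

/-- A flag is positive iff the proposition holds. [cite: AroraBarak2009, §1.3 (polynomial-time arithmetic on binary numerals)] -/
@[simp] theorem flagOf_pos (p : Prop) [Decidable p] : 0 < flagOf p ↔ p := by
  unfold flagOf; split_ifs with h <;> simp [h]

/-- A product of naturals is positive iff both factors are. [cite: AroraBarak2009, §1.3 (polynomial-time arithmetic on binary numerals)] -/
theorem pos_mul_iff (a b : ℕ) : 0 < a * b ↔ 0 < a ∧ 0 < b := by
  rcases Nat.eq_zero_or_pos a with h | h <;> rcases Nat.eq_zero_or_pos b with h' | h' <;> simp [h, h']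

/-- Conjunction of flags. [cite: KoiranPerifel2009VPSPACE, §3.2 (Uniform VPAR⁰: the syntax of a gate as a polynomial-time function of its name)] -/
@[simp] theorem eval_aand_pos (E : AEnv) (a b : AExp) : 0 < (aand a b).eval E ↔ 0 < a.eval E ∧ 0 < b.eval E := by
  rw [aand, AExp.eval_mul, pos_mul_iff]
/-- The flag `a ≤ b`. [cite: KoiranPerifel2009VPSPACE, §3.2 (Uniform VPAR⁰: the syntax of a gate as a polynomial-time function of its name)] -/
@[simp] theorem eval_ale_pos (E : AEnv) (a b : AExp) : 0 < (ale a b).eval E ↔ a.eval E ≤ b.eval E := by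
  rw [ale, AExp.eval_lt, AExp.eval_add, AExp.eval_lit]; split_ifs with h <;> simp <;> omega
/-- The flag `a < b`. [cite: KoiranPerifel2009VPSPACE, §3.2 (Uniform VPAR⁰: the syntax of a gate as a polynomial-time function of its name)] -/
@[simp] theorem eval_alt_pos (E : AEnv) (a b : AExp) : 0 < (alt a b).eval E ↔ a.eval E < b.eval E := by
  rw [alt, AExp.eval_lt]; split_ifs with h <;> simp [h]
/-- The flag `a = b`. [cite: KoiranPerifel2009VPSPACE, §3.2 (Uniform VPAR⁰: the syntax of a gate as a polynomial-time function of its name)] -/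
@[simp] theorem eval_aeq_pos (E : AEnv) (a b : AExp) : 0 < (aeq a b).eval E ↔ a.eval E = b.eval E := by
  rw [aeq, AExp.eval_beq]; split_ifs with h <;> simp [h]
/-- The conditional, with a positive-flag test (preferred to `AExp.eval_cond`). [cite: KoiranPerifel2009VPSPACE, §3.2 (Uniform VPAR⁰: the syntax of a gate as a polynomial-time function of its name)] -/
@[simp 1100] theorem eval_cond_pos (E : AEnv) (c x y : AExp) :
    (AExp.cond c x y).eval E = if 0 < c.eval E then x.eval E else y.eval E := by
  rw [AExp.eval_cond]; by_cases h : c.eval E = 0 <;> simp [h, Nat.pos_iff_ne_zero]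
/-- Positivity of a conditional. [cite: AroraBarak2009, §1.3 (polynomial-time arithmetic on binary numerals)] -/
@[simp] theorem pos_ite (p : Prop) [Decidable p] (a b : ℕ) : (0 < if p then a else b) ↔ (if p then 0 < a else 0 < b) := by
  split_ifs <;> rfl
/-- The literal `1` is a true flag. [cite: AroraBarak2009, §1.3 (polynomial-time arithmetic on binary numerals)] -/
theorem lit_pos_one (E : AEnv) : (0 < (AExp.lit 1).eval E) ↔ True := by simp
/-- The literal `0` is a false flag. [cite: AroraBarak2009, §1.3 (polynomial-time arithmetic on binary numerals)] -/
theorem lit_pos_zero (E : AEnv) : (0 < (AExp.lit 0).eval E) ↔ False := by simp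

/-! ### Reading the environment of a tuple -/

section EvalVars
variable (n len a0 a1 a2 a3 a4 a5 a6 a7 : ℕ)

/-- `ev_vTag` (plumbing). [cite: KoiranPerifel2009VPSPACE, §3.2 (Uniform VPAR⁰: the syntax of a gate as a polynomial-time function of its name)] -/
@[simp] theorem ev_vTag : vTag.eval (aenv Φ.params n len [a0, a1, a2, a3, a4, a5, a6, a7]) = a0 := rfl
/-- `ev_vS` (plumbing). [cite: KoiranPerifel2009VPSPACE, §3.2 (Uniform VPAR⁰: the syntax of a gate as a polynomial-time function of its name)] -/
@[simp] theorem ev_vS : vS.eval (aenv Φ.params n len [a0, a1, a2, a3, a4, a5, a6, a7]) = a1 := rfl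
/-- `ev_v1` (plumbing). [cite: KoiranPerifel2009VPSPACE, §3.2 (Uniform VPAR⁰: the syntax of a gate as a polynomial-time function of its name)] -/
@[simp] theorem ev_v1 : v1.eval (aenv Φ.params n len [a0, a1, a2, a3, a4, a5, a6, a7]) = a2 := rfl
/-- `ev_v2` (plumbing). [cite: KoiranPerifel2009VPSPACE, §3.2 (Uniform VPAR⁰: the syntax of a gate as a polynomial-time function of its name)] -/
@[simp] theorem ev_v2 : v2.eval (aenv Φ.params n len [a0, a1, a2, a3, a4, a5, a6, a7]) = a3 := rfl
/-- `ev_v3` (plumbing). [cite: KoiranPerifel2009VPSPACE, §3.2 (Uniform VPAR⁰: the syntax of a gate as a polynomial-time function of its name)] -/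
@[simp] theorem ev_v3 : v3.eval (aenv Φ.params n len [a0, a1, a2, a3, a4, a5, a6, a7]) = a4 := rfl
/-- `ev_v4` (plumbing). [cite: KoiranPerifel2009VPSPACE, §3.2 (Uniform VPAR⁰: the syntax of a gate as a polynomial-time function of its name)] -/
@[simp] theorem ev_v4 : v4.eval (aenv Φ.params n len [a0, a1, a2, a3, a4, a5, a6, a7]) = a5 := rfl
/-- `ev_v5` (plumbing). [cite: KoiranPerifel2009VPSPACE, §3.2 (Uniform VPAR⁰: the syntax of a gate as a polynomial-time function of its name)] -/
@[simp] theorem ev_v5 : v5.eval (aenv Φ.params n len [a0, a1, a2, a3, a4, a5, a6, a7]) = a6 := rfl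
/-- `ev_v6` (plumbing). [cite: KoiranPerifel2009VPSPACE, §3.2 (Uniform VPAR⁰: the syntax of a gate as a polynomial-time function of its name)] -/
@[simp] theorem ev_v6 : v6.eval (aenv Φ.params n len [a0, a1, a2, a3, a4, a5, a6, a7]) = a7 := rfl
/-- `ev_vN0` (plumbing). [cite: KoiranPerifel2009VPSPACE, §3.2 (Uniform VPAR⁰: the syntax of a gate as a polynomial-time function of its name)] -/
@[simp] theorem ev_vN0 : vN0.eval (aenv Φ.params n len [a0, a1, a2, a3, a4, a5, a6, a7]) = n := rfl
/-- `ev_vLen` (plumbing). [cite: KoiranPerifel2009VPSPACE, §3.2 (Uniform VPAR⁰: the syntax of a gate as a polynomial-time function of its name)] -/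
@[simp] theorem ev_vLen : vLen.eval (aenv Φ.params n len [a0, a1, a2, a3, a4, a5, a6, a7]) = len := rfl
/-- `ev_pR` (plumbing). [cite: KoiranPerifel2009VPSPACE, §3.2 (Uniform VPAR⁰: the syntax of a gate as a polynomial-time function of its name)] -/
@[simp] theorem ev_pR : pR.eval (aenv Φ.params n len [a0, a1, a2, a3, a4, a5, a6, a7]) = Φ.R n := rfl
/-- `ev_pN` (plumbing). [cite: KoiranPerifel2009VPSPACE, §3.2 (Uniform VPAR⁰: the syntax of a gate as a polynomial-time function of its name)] -/
@[simp] theorem ev_pN : pN.eval (aenv Φ.params n len [a0, a1, a2, a3, a4, a5, a6, a7]) = Φ.N n := rfl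
/-- `ev_pW0` (plumbing). [cite: KoiranPerifel2009VPSPACE, §3.2 (Uniform VPAR⁰: the syntax of a gate as a polynomial-time function of its name)] -/
@[simp] theorem ev_pW0 : pW0.eval (aenv Φ.params n len [a0, a1, a2, a3, a4, a5, a6, a7]) = Φ.W₀ n := rfl
/-- `ev_pF` (plumbing). [cite: KoiranPerifel2009VPSPACE, §3.2 (Uniform VPAR⁰: the syntax of a gate as a polynomial-time function of its name)] -/
@[simp] theorem ev_pF : pF.eval (aenv Φ.params n len [a0, a1, a2, a3, a4, a5, a6, a7]) = Φ.F n := rfl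
/-- `ev_pX` (plumbing). [cite: KoiranPerifel2009VPSPACE, §3.2 (Uniform VPAR⁰: the syntax of a gate as a polynomial-time function of its name)] -/
@[simp] theorem ev_pX : pX.eval (aenv Φ.params n len [a0, a1, a2, a3, a4, a5, a6, a7]) = Φ.X n := rfl
/-- `ev_pT` (plumbing). [cite: KoiranPerifel2009VPSPACE, §3.2 (Uniform VPAR⁰: the syntax of a gate as a polynomial-time function of its name)] -/
@[simp] theorem ev_pT : pT.eval (aenv Φ.params n len [a0, a1, a2, a3, a4, a5, a6, a7]) = Φ.T n := rfl
/-- `ev_pLmid` (plumbing). [cite: KoiranPerifel2009VPSPACE, §3.2 (Uniform VPAR⁰: the syntax of a gate as a polynomial-time function of its name)] -/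
@[simp] theorem ev_pLmid : pLmid.eval (aenv Φ.params n len [a0, a1, a2, a3, a4, a5, a6, a7]) = Φ.Lmid n := rfl
/-- `ev_pWmux` (plumbing). [cite: KoiranPerifel2009VPSPACE, §3.2 (Uniform VPAR⁰: the syntax of a gate as a polynomial-time function of its name)] -/
@[simp] theorem ev_pWmux : pWmux.eval (aenv Φ.params n len [a0, a1, a2, a3, a4, a5, a6, a7]) = Φ.Wmux n := rfl
/-- `ev_pLreq` (plumbing). [cite: KoiranPerifel2009VPSPACE, §3.2 (Uniform VPAR⁰: the syntax of a gate as a polynomial-time function of its name)] -/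
@[simp] theorem ev_pLreq : pLreq.eval (aenv Φ.params n len [a0, a1, a2, a3, a4, a5, a6, a7]) = Φ.Lreq n := rfl
/-- `ev_pFb` (plumbing). [cite: KoiranPerifel2009VPSPACE, §3.2 (Uniform VPAR⁰: the syntax of a gate as a polynomial-time function of its name)] -/
@[simp] theorem ev_pFb : pFb.eval (aenv Φ.params n len [a0, a1, a2, a3, a4, a5, a6, a7]) = Φ.Fb n := rfl
/-- `ev_pFB` (plumbing). [cite: KoiranPerifel2009VPSPACE, §3.2 (Uniform VPAR⁰: the syntax of a gate as a polynomial-time function of its name)] -/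
@[simp] theorem ev_pFB : pFB.eval (aenv Φ.params n len [a0, a1, a2, a3, a4, a5, a6, a7]) = Φ.FB n := rfl
/-- `ev_sz0` (plumbing). [cite: KoiranPerifel2009VPSPACE, §3.2 (Uniform VPAR⁰: the syntax of a gate as a polynomial-time function of its name)] -/
@[simp] theorem ev_sz0 : (vSz 0).eval (aenv Φ.params n len [a0, a1, a2, a3, a4, a5, a6, a7]) = Nat.size a0 := rfl
/-- `ev_sz1` (plumbing). [cite: KoiranPerifel2009VPSPACE, §3.2 (Uniform VPAR⁰: the syntax of a gate as a polynomial-time function of its name)] -/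
@[simp] theorem ev_sz1 : (vSz 1).eval (aenv Φ.params n len [a0, a1, a2, a3, a4, a5, a6, a7]) = Nat.size a1 := rfl
/-- `ev_sz2` (plumbing). [cite: KoiranPerifel2009VPSPACE, §3.2 (Uniform VPAR⁰: the syntax of a gate as a polynomial-time function of its name)] -/
@[simp] theorem ev_sz2 : (vSz 2).eval (aenv Φ.params n len [a0, a1, a2, a3, a4, a5, a6, a7]) = Nat.size a2 := rfl
/-- `ev_sz3` (plumbing). [cite: KoiranPerifel2009VPSPACE, §3.2 (Uniform VPAR⁰: the syntax of a gate as a polynomial-time function of its name)] -/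
@[simp] theorem ev_sz3 : (vSz 3).eval (aenv Φ.params n len [a0, a1, a2, a3, a4, a5, a6, a7]) = Nat.size a3 := rfl
/-- `ev_sz4` (plumbing). [cite: KoiranPerifel2009VPSPACE, §3.2 (Uniform VPAR⁰: the syntax of a gate as a polynomial-time function of its name)] -/
@[simp] theorem ev_sz4 : (vSz 4).eval (aenv Φ.params n len [a0, a1, a2, a3, a4, a5, a6, a7]) = Nat.size a4 := rfl

/-- child environments: the index [cite: KoiranPerifel2009VPSPACE, §3.2 (Uniform VPAR⁰: the syntax of a gate as a polynomial-time function of its name)] -/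
@[simp] theorem evK_cK (k : ℕ) : cK.eval (aenvK Φ.params n len [a0, a1, a2, a3, a4, a5, a6, a7] k) = k := rfl
/-- child environments: shifted expressions [cite: KoiranPerifel2009VPSPACE, §3.2 (Uniform VPAR⁰: the syntax of a gate as a polynomial-time function of its name)] -/
@[simp] theorem evK_bump (k : ℕ) (e : AExp) :
    (bump e).eval (aenvK Φ.params n len [a0, a1, a2, a3, a4, a5, a6, a7] k) = e.eval (aenv Φ.params n len [a0, a1, a2, a3, a4, a5, a6, a7]) :=
  eval_bump k _ _ e

/-- The label-decoding expressions, read in Lean. [cite: MahajanVinay1999, §3.1] -/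
@[simp] theorem ev_mKap : mKap.eval (aenv Φ.params n len [a0, a1, a2, a3, a4, a5, a6, a7]) = mKapL Φ n a2 a3 := by
  simp [mKap, mKapL]
/-- `ev_mRow` (plumbing). [cite: KoiranPerifel2009VPSPACE, §3.2 (Uniform VPAR⁰: the syntax of a gate as a polynomial-time function of its name)] -/
@[simp] theorem ev_mRow : mRow.eval (aenv Φ.params n len [a0, a1, a2, a3, a4, a5, a6, a7]) = mRowL Φ n a2 a3 := by
  simp [mRow, mRowL]
/-- `ev_mCol` (plumbing). [cite: KoiranPerifel2009VPSPACE, §3.2 (Uniform VPAR⁰: the syntax of a gate as a polynomial-time function of its name)] -/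
@[simp] theorem ev_mCol : mCol.eval (aenv Φ.params n len [a0, a1, a2, a3, a4, a5, a6, a7]) = mColL Φ n a2 a3 := by
  simp [mCol, mColL]

end EvalVars

section Dispatch
variable {n len a0 a1 a2 a3 a4 a5 a6 a7 : ℕ}

/-- Dispatch on the tag evaluates the selected expression. [cite: KoiranPerifel2009VPSPACE, §3.2] -/
theorem bytag_eval (f : ℕ → AExp) (ha : a0 ≤ 30) : (bytag f).eval (aenv Φ.params n len [a0, a1, a2, a3, a4, a5, a6, a7]) = (f a0).eval (aenv Φ.params n len [a0, a1, a2, a3, a4, a5, a6, a7]) := by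
  interval_cases a0 <;> simp [bytag]

/-- Dispatch beyond the table. [cite: KoiranPerifel2009VPSPACE, §3.2 (Uniform VPAR⁰: the syntax of a gate as a polynomial-time function of its name)] -/
theorem bytag_eval_gt (f : ℕ → AExp) (ha : 30 < a0) : (bytag f).eval (aenv Φ.params n len [a0, a1, a2, a3, a4, a5, a6, a7]) = 0 := by
  simp only [bytag, eval_cond_pos, eval_aeq_pos, ev_vTag, AExp.eval_lit]
  repeat (rw [if_neg (by omega)])

/-- Dispatch on the tag, child environment. [cite: KoiranPerifel2009VPSPACE, §3.2] -/
theorem bytagK_eval (f : ℕ → AExp) (ha : a0 ≤ 30) (k : ℕ) :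
    (bytagK f).eval (aenvK Φ.params n len [a0, a1, a2, a3, a4, a5, a6, a7] k) =
      (f a0).eval (aenvK Φ.params n len [a0, a1, a2, a3, a4, a5, a6, a7] k) := by
  interval_cases a0 <;> simp [bytagK]

end Dispatch

/-! ### Well-formedness, read in Lean -/

/-- The generic conditions. [cite: KoiranPerifel2009VPSPACE, §3.2] -/
def GWF (n len c s f1 f2 f3 f4 f5 f6 : ℕ) : Prop :=
  c ≤ 30 ∧ s ≤ 1 ∧ f1 < Φ.FB n ∧ f2 < Φ.FB n ∧ f3 < Φ.FB n ∧ f4 < Φ.FB n ∧ f5 < Φ.FB n ∧ f6 < Φ.FB n ∧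
    Φ.Lreq n ≤ len ∧ 0 < Φ.N n

/-- **Well-formedness of a tuple** of the `n`-th circuit at name length `len`: the Lean reading of
the flag `wf` (`wf_iff`). [cite: KoiranPerifel2009VPSPACE, §3.2] -/
def WF (n len : ℕ) (t : List ℕ) : Prop :=
  GWF Φ n len (t.getD 0 0) (t.getD 1 0) (t.getD 2 0) (t.getD 3 0) (t.getD 4 0) (t.getD 5 0) (t.getD 6 0) (t.getD 7 0) ∧
    WFt Φ n (t.getD 0 0) (t.getD 1 0) (t.getD 2 0) (t.getD 3 0) (t.getD 4 0) (t.getD 5 0) (t.getD 6 0) (t.getD 7 0)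

section WFBridge
variable {n len a0 a1 a2 a3 a4 a5 a6 a7 : ℕ}

/-- `gwf_iff` (plumbing). [cite: KoiranPerifel2009VPSPACE, §3.2 (Uniform VPAR⁰: the syntax of a gate as a polynomial-time function of its name)] -/
theorem gwf_iff : 0 < wfGen.eval (aenv Φ.params n len [a0, a1, a2, a3, a4, a5, a6, a7]) ↔
    GWF Φ n len a0 a1 a2 a3 a4 a5 a6 a7 := by
  simp [wfGen, GWF]

/-- `wfT_iff` (plumbing). [cite: KoiranPerifel2009VPSPACE, §3.2 (Uniform VPAR⁰: the syntax of a gate as a polynomial-time function of its name)] -/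
theorem wfT_iff (ha : a0 ≤ 30) : 0 < (wfT a0).eval (aenv Φ.params n len [a0, a1, a2, a3, a4, a5, a6, a7]) ↔
    WFt Φ n a0 a1 a2 a3 a4 a5 a6 a7 := by
  interval_cases a0 <;> simp [wfT, WFt]

/-- **The flag `wf` reads as `WF`.** [cite: KoiranPerifel2009VPSPACE, §3.2] -/
theorem wf_iff : 0 < wf.eval (aenv Φ.params n len [a0, a1, a2, a3, a4, a5, a6, a7]) ↔
    WF Φ n len [a0, a1, a2, a3, a4, a5, a6, a7] := by
  rw [wf, eval_aand_pos, gwf_iff, WF]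
  simp only [List.getD_cons_zero, List.getD_cons_succ]
  by_cases ha : a0 ≤ 30
  · rw [bytag_eval Φ _ ha, wfT_iff Φ ha]
  · constructor
    · rintro ⟨h, _⟩; exact absurd h.1 ha
    · rintro ⟨h, _⟩; exact absurd h.1 ha

end WFBridge

/-! ### The syntax maps on tuples: general facts -/

section SyntaxGeneral
variable {n len : ℕ}

/-- `exists_eq_eight` (plumbing). [cite: AroraBarak2009, §1.3 (polynomial-time arithmetic on binary numerals)] -/
theorem exists_eq_eight {t : List ℕ} (ht : t.length = 8) :
    ∃ a0 a1 a2 a3 a4 a5 a6 a7, t = [a0, a1, a2, a3, a4, a5, a6, a7] := by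
  match t, ht with
  | [a0, a1, a2, a3, a4, a5, a6, a7], _ => exact ⟨a0, a1, a2, a3, a4, a5, a6, a7, rfl⟩

/-- `kind_of_not_wf` (plumbing). [cite: KoiranPerifel2009VPSPACE, §3.2 (Uniform VPAR⁰: the syntax of a gate as a polynomial-time function of its name)] -/
theorem kind_of_not_wf {t : List ℕ} (ht : t.length = 8) (h : ¬ WF Φ n len t) :
    kindX.eval (aenv Φ.params n len t) = 0 := by
  obtain ⟨a0, a1, a2, a3, a4, a5, a6, a7, rfl⟩ := exists_eq_eight ht
  rw [kindX, eval_cond_pos, if_neg (mt (wf_iff Φ ..).1 h), AExp.eval_lit]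

/-- `wf_of_kind_pos` (plumbing). [cite: KoiranPerifel2009VPSPACE, §3.2 (Uniform VPAR⁰: the syntax of a gate as a polynomial-time function of its name)] -/
theorem wf_of_kind_pos {t : List ℕ} (ht : t.length = 8) (h : 0 < kindX.eval (aenv Φ.params n len t)) :
    WF Φ n len t := by
  by_contra hw; rw [kind_of_not_wf Φ ht hw] at h; exact lt_irrefl 0 h

/-- `depth_of_not_wf` (plumbing). [cite: KoiranPerifel2009VPSPACE, §3.2 (Uniform VPAR⁰: the syntax of a gate as a polynomial-time function of its name)] -/
theorem depth_of_not_wf {t : List ℕ} (ht : t.length = 8) (h : ¬ WF Φ n len t) :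
    depthX.eval (aenv Φ.params n len t) = 0 := by
  obtain ⟨a0, a1, a2, a3, a4, a5, a6, a7, rfl⟩ := exists_eq_eight ht
  rw [depthX, eval_cond_pos, if_neg (mt (wf_iff Φ ..).1 h), AExp.eval_lit]

/-- `width_of_not_wf` (plumbing). [cite: KoiranPerifel2009VPSPACE, §3.2 (Uniform VPAR⁰: the syntax of a gate as a polynomial-time function of its name)] -/
theorem width_of_not_wf {t : List ℕ} (ht : t.length = 8) (h : ¬ WF Φ n len t) :
    widthX.eval (aenv Φ.params n len t) = 0 := by
  obtain ⟨a0, a1, a2, a3, a4, a5, a6, a7, rfl⟩ := exists_eq_eight ht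
  rw [widthX, eval_cond_pos, if_neg (mt (wf_iff Φ ..).1 h), AExp.eval_lit]

/-- `arity_of_not_wf` (plumbing). [cite: KoiranPerifel2009VPSPACE, §3.2 (Uniform VPAR⁰: the syntax of a gate as a polynomial-time function of its name)] -/
theorem arity_of_not_wf {t : List ℕ} (ht : t.length = 8) (h : ¬ WF Φ n len t) :
    arityX.eval (aenv Φ.params n len t) = 0 := by
  obtain ⟨a0, a1, a2, a3, a4, a5, a6, a7, rfl⟩ := exists_eq_eight ht
  rw [arityX, eval_cond_pos, if_neg (mt (wf_iff Φ ..).1 h), AExp.eval_lit]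

/-- `tag_le_of_wf` (plumbing). [cite: KoiranPerifel2009VPSPACE, §3.2 (Uniform VPAR⁰: the syntax of a gate as a polynomial-time function of its name)] -/
theorem tag_le_of_wf {t : List ℕ} (h : WF Φ n len t) : t.getD 0 0 ≤ 30 := h.1.1

/-- The core of a tuple with fields below the field bound fits in the required length. [cite: KoiranPerifel2009VPSPACE, §3.2 (Uniform VPAR⁰: the syntax of a gate as a polynomial-time function of its name)] -/
theorem fits8 {x0 x1 x2 x3 x4 x5 x6 x7 : ℕ} (h0 : x0 < Φ.FB n) (h1 : x1 < Φ.FB n) (h2 : x2 < Φ.FB n)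
    (h3 : x3 < Φ.FB n) (h4 : x4 < Φ.FB n) (h5 : x5 < Φ.FB n) (h6 : x6 < Φ.FB n) (h7 : x7 < Φ.FB n)
    (hlen : Φ.Lreq n ≤ len) : (gcore n [x0, x1, x2, x3, x4, x5, x6, x7]).length ≤ len := by
  have h := length_gcore_le (n := n) (t := [x0, x1, x2, x3, x4, x5, x6, x7]) (B := Φ.Fb n) (by
    intro a ha; simp only [List.mem_cons, List.mem_nil_iff, or_false] at ha
    unfold SuccIntMatrixFamily.FB at *
    rcases ha with rfl | rfl | rfl | rfl | rfl | rfl | rfl | rfl <;> assumption)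
  unfold SuccIntMatrixFamily.Lreq at hlen
  simp only [List.length_cons, List.length_nil] at h
  omega

/-- Halving drops one bit. [cite: AroraBarak2009, §1.3 (polynomial-time arithmetic on binary numerals)] -/
theorem size_div_two {j : ℕ} (hj : 0 < j) : Nat.size (j / 2) + 1 = Nat.size j := by
  apply le_antisymm
  · have : Nat.size (j / 2) ≤ Nat.size j - 1 :=
      Nat.size_le.2 (by
        have h := Nat.lt_size_self j
        have hs : 0 < Nat.size j := Nat.size_pos.2 hj
        obtain ⟨e, he⟩ : ∃ e, Nat.size j = e + 1 := ⟨Nat.size j - 1, by omega⟩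
        rw [he, pow_succ] at h; rw [he, Nat.add_sub_cancel]; omega)
    have hs : 0 < Nat.size j := Nat.size_pos.2 hj
    omega
  · exact Nat.size_le.2 (by have h := Nat.lt_size_self (j / 2); rw [pow_succ]; omega)

/-- `length_chT` (plumbing). [cite: KoiranPerifel2009VPSPACE, §3.2 (Uniform VPAR⁰: the syntax of a gate as a polynomial-time function of its name)] -/
theorem length_chT (c : ℕ) : (chT c).length = 8 := by
  unfold chT; split <;> rfl

/-- `eq_getD_eight` (plumbing). [cite: AroraBarak2009, §1.3 (polynomial-time arithmetic on binary numerals)] -/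
theorem eq_getD_eight {l : List AExp} (hl : l.length = 8) (d : AExp) :
    l = [l.getD 0 d, l.getD 1 d, l.getD 2 d, l.getD 3 d, l.getD 4 d, l.getD 5 d, l.getD 6 d, l.getD 7 d] := by
  match l, hl with
  | [b0, b1, b2, b3, b4, b5, b6, b7], _ => rfl

/-- **The children of a canonical tuple are the tag's child tuple.** [cite: KoiranPerifel2009VPSPACE, §3.2] -/
theorem childX_eval {s f1 f2 f3 f4 f5 f6 c : ℕ} (hc : c ≤ 30) (k : ℕ) :
    childX.map (AExp.eval (aenvK Φ.params n len [c, s, f1, f2, f3, f4, f5, f6] k)) =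
      (chT c).map (AExp.eval (aenvK Φ.params n len [c, s, f1, f2, f3, f4, f5, f6] k)) := by
  conv_rhs => rw [eq_getD_eight (length_chT c) (.lit 0)]
  simp only [childX, List.map_cons, List.map_nil, bytagK_eval Φ _ hc]

end SyntaxGeneral

/-! ### The syntax maps on canonical tuples, tag by tag (generated) -/

section SyntaxTags
variable {n len s f1 f2 f3 f4 f5 f6 : ℕ}


/-! #### Tag 0: the constant `1` -/

/-- Well-formedness of `ONE`. [cite: KoiranPerifel2009VPSPACE, §3.2] -/
theorem wf_ONE : WF Φ n len [0, s, f1, f2, f3, f4, f5, f6] ↔ (GWF Φ n len 0 s f1 f2 f3 f4 f5 f6 ∧ (True)) := by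
  simp only [WF, WFt, List.getD_cons_zero, List.getD_cons_succ]

/-- The kind of `ONE`. [cite: KoiranPerifel2009VPSPACE, §3.2] -/
theorem kind_ONE (h : WF Φ n len [0, s, f1, f2, f3, f4, f5, f6]) : kindX.eval (aenv Φ.params n len [0, s, f1, f2, f3, f4, f5, f6]) = 0 := by
  rw [kindX, eval_cond_pos, if_pos ((wf_iff Φ ..).2 h), bytag_eval Φ _ (by norm_num)]; simp [kindT]

/-- The width of `ONE`. [cite: KoiranPerifel2009VPSPACE, §3.2] -/
theorem width_ONE (h : WF Φ n len [0, s, f1, f2, f3, f4, f5, f6]) : widthX.eval (aenv Φ.params n len [0, s, f1, f2, f3, f4, f5, f6]) = 1 := by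
  rw [widthX, eval_cond_pos, if_pos ((wf_iff Φ ..).2 h), bytag_eval Φ _ (by norm_num)]; simp [widthT]

/-- The depth of `ONE`. [cite: KoiranPerifel2009VPSPACE, §3.2] -/
theorem depth_ONE (h : WF Φ n len [0, s, f1, f2, f3, f4, f5, f6]) : depthX.eval (aenv Φ.params n len [0, s, f1, f2, f3, f4, f5, f6]) = 0 := by
  rw [depthX, eval_cond_pos, if_pos ((wf_iff Φ ..).2 h), bytag_eval Φ _ (by norm_num)]; simp [depthT]

/-! #### Tag 1: `A(s,r,c)`: the `s`-part of the entry `A n r c` -/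

/-- Well-formedness of `A`. [cite: KoiranPerifel2009VPSPACE, §3.2] -/
theorem wf_A : WF Φ n len [1, s, f1, f2, f3, f4, f5, f6] ↔ (GWF Φ n len 1 s f1 f2 f3 f4 f5 f6 ∧ (f1 < (Φ.R n) ∧ (f2 < (Φ.N n)))) := by
  simp only [WF, WFt, List.getD_cons_zero, List.getD_cons_succ]

/-- The kind of `A`. [cite: KoiranPerifel2009VPSPACE, §3.2] -/
theorem kind_A (h : WF Φ n len [1, s, f1, f2, f3, f4, f5, f6]) : kindX.eval (aenv Φ.params n len [1, s, f1, f2, f3, f4, f5, f6]) = 0 := by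
  rw [kindX, eval_cond_pos, if_pos ((wf_iff Φ ..).2 h), bytag_eval Φ _ (by norm_num)]; simp [kindT]

/-- The width of `A`. [cite: KoiranPerifel2009VPSPACE, §3.2] -/
theorem width_A (h : WF Φ n len [1, s, f1, f2, f3, f4, f5, f6]) : widthX.eval (aenv Φ.params n len [1, s, f1, f2, f3, f4, f5, f6]) = (Φ.W₀ n) := by
  rw [widthX, eval_cond_pos, if_pos ((wf_iff Φ ..).2 h), bytag_eval Φ _ (by norm_num)]; simp [widthT]

/-- The depth of `A`. [cite: KoiranPerifel2009VPSPACE, §3.2] -/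
theorem depth_A (h : WF Φ n len [1, s, f1, f2, f3, f4, f5, f6]) : depthX.eval (aenv Φ.params n len [1, s, f1, f2, f3, f4, f5, f6]) = 0 := by
  rw [depthX, eval_cond_pos, if_pos ((wf_iff Φ ..).2 h), bytag_eval Φ _ (by norm_num)]; simp [depthT]

/-! #### Tag 2: `B(s,c,c')`: the `s`-part of `(AᵀA) c c' = Σ_r A r c · A r c'` -/

/-- Well-formedness of `B`. [cite: KoiranPerifel2009VPSPACE, §3.2] -/
theorem wf_B : WF Φ n len [2, s, f1, f2, f3, f4, f5, f6] ↔ (GWF Φ n len 2 s f1 f2 f3 f4 f5 f6 ∧ (f1 < (Φ.N n) ∧ (f2 < (Φ.N n)))) := by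
  simp only [WF, WFt, List.getD_cons_zero, List.getD_cons_succ]

/-- The kind of `B`. [cite: KoiranPerifel2009VPSPACE, §3.2] -/
theorem kind_B (h : WF Φ n len [2, s, f1, f2, f3, f4, f5, f6]) : kindX.eval (aenv Φ.params n len [2, s, f1, f2, f3, f4, f5, f6]) = 1 := by
  rw [kindX, eval_cond_pos, if_pos ((wf_iff Φ ..).2 h), bytag_eval Φ _ (by norm_num)]; simp [kindT]

/-- The arity of `B`. [cite: KoiranPerifel2009VPSPACE, §3.2] -/
theorem arity_B (h : WF Φ n len [2, s, f1, f2, f3, f4, f5, f6]) : arityX.eval (aenv Φ.params n len [2, s, f1, f2, f3, f4, f5, f6]) = (2 * (Φ.R n)) := by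
  rw [arityX, eval_cond_pos, if_pos ((wf_iff Φ ..).2 h), bytag_eval Φ _ (by norm_num)]; simp [arityT]

/-- The depth of `B`. [cite: KoiranPerifel2009VPSPACE, §3.2] -/
theorem depth_B (h : WF Φ n len [2, s, f1, f2, f3, f4, f5, f6]) : depthX.eval (aenv Φ.params n len [2, s, f1, f2, f3, f4, f5, f6]) = 2 := by
  rw [depthX, eval_cond_pos, if_pos ((wf_iff Φ ..).2 h), bytag_eval Φ _ (by norm_num)]; simp [depthT]

/-- The children of `B`. [cite: KoiranPerifel2009VPSPACE, §3.2] -/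
theorem child_B (k : ℕ) : childX.map (AExp.eval (aenvK Φ.params n len [2, s, f1, f2, f3, f4, f5, f6] k)) = [3, s, f1, f2, k, 0, 0, 0] := by
  rw [childX_eval Φ (by norm_num)]; simp [chT]

/-! #### Tag 3: `PA(s,c,c',k)`: the product `A^e r c · A^{e⊕s} r c'`, `r = k/2`, `e = k%2` -/

/-- Well-formedness of `PA`. [cite: KoiranPerifel2009VPSPACE, §3.2] -/
theorem wf_PA : WF Φ n len [3, s, f1, f2, f3, f4, f5, f6] ↔ (GWF Φ n len 3 s f1 f2 f3 f4 f5 f6 ∧ (f1 < (Φ.N n) ∧ (f2 < (Φ.N n) ∧ (f3 < (2 * (Φ.R n)))))) := by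
  simp only [WF, WFt, List.getD_cons_zero, List.getD_cons_succ]

/-- The kind of `PA`. [cite: KoiranPerifel2009VPSPACE, §3.2] -/
theorem kind_PA (h : WF Φ n len [3, s, f1, f2, f3, f4, f5, f6]) : kindX.eval (aenv Φ.params n len [3, s, f1, f2, f3, f4, f5, f6]) = 2 := by
  rw [kindX, eval_cond_pos, if_pos ((wf_iff Φ ..).2 h), bytag_eval Φ _ (by norm_num)]; simp [kindT]

/-- The depth of `PA`. [cite: KoiranPerifel2009VPSPACE, §3.2] -/
theorem depth_PA (h : WF Φ n len [3, s, f1, f2, f3, f4, f5, f6]) : depthX.eval (aenv Φ.params n len [3, s, f1, f2, f3, f4, f5, f6]) = 1 := by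
  rw [depthX, eval_cond_pos, if_pos ((wf_iff Φ ..).2 h), bytag_eval Φ _ (by norm_num)]; simp [depthT]

/-- Child `0` of `PA`. [cite: KoiranPerifel2009VPSPACE, §3.2] -/
theorem child_PA_0 : childX.map (AExp.eval (aenvK Φ.params n len [3, s, f1, f2, f3, f4, f5, f6] 0)) = [1, (f3 % 2), (f3 / 2), f1, 0, 0, 0, 0] := by
  rw [childX_eval Φ (by norm_num)]; simp [chT]

/-- Child `1` of `PA`. [cite: KoiranPerifel2009VPSPACE, §3.2] -/
theorem child_PA_1 : childX.map (AExp.eval (aenvK Φ.params n len [3, s, f1, f2, f3, f4, f5, f6] 1)) = [1, (((f3 % 2) + s) % 2), (f3 / 2), f2, 0, 0, 0, 0] := by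
  rw [childX_eval Φ (by norm_num)]; simp [chT]

/-! #### Tag 4: `M(s,x,y)`: the `s`-part of the entry `(x,y)` of the reindexed all-coefficients matrix `mvCharAdj (AᵀA)` (by label decoding: `0`, `1`, or `±` an entry of `AᵀA`) -/

/-- Well-formedness of `M`. [cite: KoiranPerifel2009VPSPACE, §3.2] -/
theorem wf_M : WF Φ n len [4, s, f1, f2, f3, f4, f5, f6] ↔ (GWF Φ n len 4 s f1 f2 f3 f4 f5 f6 ∧ (f1 < (Φ.X n) ∧ (f2 < (Φ.X n)))) := by
  simp only [WF, WFt, List.getD_cons_zero, List.getD_cons_succ]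

/-- The kind of `M`. [cite: KoiranPerifel2009VPSPACE, §3.2] -/
theorem kind_M (h : WF Φ n len [4, s, f1, f2, f3, f4, f5, f6]) : kindX.eval (aenv Φ.params n len [4, s, f1, f2, f3, f4, f5, f6]) = 1 := by
  rw [kindX, eval_cond_pos, if_pos ((wf_iff Φ ..).2 h), bytag_eval Φ _ (by norm_num)]; simp [kindT]

/-- The arity of `M`. [cite: KoiranPerifel2009VPSPACE, §3.2] -/
theorem arity_M (h : WF Φ n len [4, s, f1, f2, f3, f4, f5, f6]) : arityX.eval (aenv Φ.params n len [4, s, f1, f2, f3, f4, f5, f6]) = (if (mKapL Φ n f1 f2) = 1 then (if s = 0 then 1 else 0) else (if (mKapL Φ n f1 f2) = 3 then 1 else (if (mKapL Φ n f1 f2) = 4 then 1 else 0))) := by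
  rw [arityX, eval_cond_pos, if_pos ((wf_iff Φ ..).2 h), bytag_eval Φ _ (by norm_num)]; simp [arityT]

/-- The depth of `M`. [cite: KoiranPerifel2009VPSPACE, §3.2] -/
theorem depth_M (h : WF Φ n len [4, s, f1, f2, f3, f4, f5, f6]) : depthX.eval (aenv Φ.params n len [4, s, f1, f2, f3, f4, f5, f6]) = 3 := by
  rw [depthX, eval_cond_pos, if_pos ((wf_iff Φ ..).2 h), bytag_eval Φ _ (by norm_num)]; simp [depthT]

/-- The children of `M`. [cite: KoiranPerifel2009VPSPACE, §3.2] -/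
theorem child_M (k : ℕ) : childX.map (AExp.eval (aenvK Φ.params n len [4, s, f1, f2, f3, f4, f5, f6] k)) = [(if (mKapL Φ n f1 f2) = 1 then 0 else 2), (if (mKapL Φ n f1 f2) = 1 then 0 else (if (mKapL Φ n f1 f2) = 3 then s else (1 - s))), (if (mKapL Φ n f1 f2) = 1 then 0 else (mRowL Φ n f1 f2)), (if (mKapL Φ n f1 f2) = 1 then 0 else (mColL Φ n f1 f2)), 0, 0, 0, 0] := by
  rw [childX_eval Φ (by norm_num)]; simp [chT]

/-! #### Tag 5: `P(s,t,x,y)`: the `s`-part of the entry `(x,y)` of the `2^t`-th power of `M` -/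

/-- Well-formedness of `P`. [cite: KoiranPerifel2009VPSPACE, §3.2] -/
theorem wf_P : WF Φ n len [5, s, f1, f2, f3, f4, f5, f6] ↔ (GWF Φ n len 5 s f1 f2 f3 f4 f5 f6 ∧ (f1 ≤ (Φ.T n) ∧ (f2 < (Φ.X n) ∧ (f3 < (Φ.X n))))) := by
  simp only [WF, WFt, List.getD_cons_zero, List.getD_cons_succ]

/-- The kind of `P`. [cite: KoiranPerifel2009VPSPACE, §3.2] -/
theorem kind_P (h : WF Φ n len [5, s, f1, f2, f3, f4, f5, f6]) : kindX.eval (aenv Φ.params n len [5, s, f1, f2, f3, f4, f5, f6]) = 1 := by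
  rw [kindX, eval_cond_pos, if_pos ((wf_iff Φ ..).2 h), bytag_eval Φ _ (by norm_num)]; simp [kindT]

/-- The arity of `P`. [cite: KoiranPerifel2009VPSPACE, §3.2] -/
theorem arity_P (h : WF Φ n len [5, s, f1, f2, f3, f4, f5, f6]) : arityX.eval (aenv Φ.params n len [5, s, f1, f2, f3, f4, f5, f6]) = (if f1 = 0 then 1 else (2 * (Φ.X n))) := by
  rw [arityX, eval_cond_pos, if_pos ((wf_iff Φ ..).2 h), bytag_eval Φ _ (by norm_num)]; simp [arityT]

/-- The depth of `P`. [cite: KoiranPerifel2009VPSPACE, §3.2] -/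
theorem depth_P (h : WF Φ n len [5, s, f1, f2, f3, f4, f5, f6]) : depthX.eval (aenv Φ.params n len [5, s, f1, f2, f3, f4, f5, f6]) = ((2 * f1) + 4) := by
  rw [depthX, eval_cond_pos, if_pos ((wf_iff Φ ..).2 h), bytag_eval Φ _ (by norm_num)]; simp [depthT]

/-- The children of `P`. [cite: KoiranPerifel2009VPSPACE, §3.2] -/
theorem child_P (k : ℕ) : childX.map (AExp.eval (aenvK Φ.params n len [5, s, f1, f2, f3, f4, f5, f6] k)) = [(if f1 = 0 then 4 else 6), (if f1 = 0 then s else s), (if f1 = 0 then f2 else f1), (if f1 = 0 then f3 else f2), (if f1 = 0 then 0 else f3), (if f1 = 0 then 0 else k), (if f1 = 0 then 0 else 0), (if f1 = 0 then 0 else 0)] := by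
  rw [childX_eval Φ (by norm_num)]; simp [chT]

/-! #### Tag 6: `PP(s,t,x,y,k)`: the product `P^e(t-1) x z · P^{e⊕s}(t-1) z y`, `z = k/2` -/

/-- Well-formedness of `PP`. [cite: KoiranPerifel2009VPSPACE, §3.2] -/
theorem wf_PP : WF Φ n len [6, s, f1, f2, f3, f4, f5, f6] ↔ (GWF Φ n len 6 s f1 f2 f3 f4 f5 f6 ∧ (0 < f1 ∧ (f1 ≤ (Φ.T n) ∧ (f2 < (Φ.X n) ∧ (f3 < (Φ.X n) ∧ (f4 < (2 * (Φ.X n)))))))) := by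
  simp only [WF, WFt, List.getD_cons_zero, List.getD_cons_succ]

/-- The kind of `PP`. [cite: KoiranPerifel2009VPSPACE, §3.2] -/
theorem kind_PP (h : WF Φ n len [6, s, f1, f2, f3, f4, f5, f6]) : kindX.eval (aenv Φ.params n len [6, s, f1, f2, f3, f4, f5, f6]) = 2 := by
  rw [kindX, eval_cond_pos, if_pos ((wf_iff Φ ..).2 h), bytag_eval Φ _ (by norm_num)]; simp [kindT]

/-- The depth of `PP`. [cite: KoiranPerifel2009VPSPACE, §3.2] -/
theorem depth_PP (h : WF Φ n len [6, s, f1, f2, f3, f4, f5, f6]) : depthX.eval (aenv Φ.params n len [6, s, f1, f2, f3, f4, f5, f6]) = ((2 * f1) + 3) := by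
  rw [depthX, eval_cond_pos, if_pos ((wf_iff Φ ..).2 h), bytag_eval Φ _ (by norm_num)]; simp [depthT]

/-- Child `0` of `PP`. [cite: KoiranPerifel2009VPSPACE, §3.2] -/
theorem child_PP_0 : childX.map (AExp.eval (aenvK Φ.params n len [6, s, f1, f2, f3, f4, f5, f6] 0)) = [5, (f4 % 2), (f1 - 1), f2, (f4 / 2), 0, 0, 0] := by
  rw [childX_eval Φ (by norm_num)]; simp [chT]

/-- Child `1` of `PP`. [cite: KoiranPerifel2009VPSPACE, §3.2] -/
theorem child_PP_1 : childX.map (AExp.eval (aenvK Φ.params n len [6, s, f1, f2, f3, f4, f5, f6] 1)) = [5, (((f4 % 2) + s) % 2), (f1 - 1), (f4 / 2), f3, 0, 0, 0] := by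
  rw [childX_eval Φ (by norm_num)]; simp [chT]

/-! #### Tag 7: `C(s,i)`: the `s`-part of the coefficient `i` of the characteristic polynomial of `AᵀA` (`0` for `i > N`) -/

/-- Well-formedness of `C`. [cite: KoiranPerifel2009VPSPACE, §3.2] -/
theorem wf_C : WF Φ n len [7, s, f1, f2, f3, f4, f5, f6] ↔ (GWF Φ n len 7 s f1 f2 f3 f4 f5 f6 ∧ (f1 ≤ (2 * (Φ.N n)))) := by
  simp only [WF, WFt, List.getD_cons_zero, List.getD_cons_succ]

/-- The kind of `C`. [cite: KoiranPerifel2009VPSPACE, §3.2] -/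
theorem kind_C (h : WF Φ n len [7, s, f1, f2, f3, f4, f5, f6]) : kindX.eval (aenv Φ.params n len [7, s, f1, f2, f3, f4, f5, f6]) = 1 := by
  rw [kindX, eval_cond_pos, if_pos ((wf_iff Φ ..).2 h), bytag_eval Φ _ (by norm_num)]; simp [kindT]

/-- The arity of `C`. [cite: KoiranPerifel2009VPSPACE, §3.2] -/
theorem arity_C (h : WF Φ n len [7, s, f1, f2, f3, f4, f5, f6]) : arityX.eval (aenv Φ.params n len [7, s, f1, f2, f3, f4, f5, f6]) = (if f1 ≤ (Φ.N n) then 1 else 0) := by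
  rw [arityX, eval_cond_pos, if_pos ((wf_iff Φ ..).2 h), bytag_eval Φ _ (by norm_num)]; simp [arityT]

/-- The depth of `C`. [cite: KoiranPerifel2009VPSPACE, §3.2] -/
theorem depth_C (h : WF Φ n len [7, s, f1, f2, f3, f4, f5, f6]) : depthX.eval (aenv Φ.params n len [7, s, f1, f2, f3, f4, f5, f6]) = ((2 * (Φ.T n)) + 5) := by
  rw [depthX, eval_cond_pos, if_pos ((wf_iff Φ ..).2 h), bytag_eval Φ _ (by norm_num)]; simp [depthT]

/-- The children of `C`. [cite: KoiranPerifel2009VPSPACE, §3.2] -/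
theorem child_C (k : ℕ) : childX.map (AExp.eval (aenvK Φ.params n len [7, s, f1, f2, f3, f4, f5, f6] k)) = [5, s, (Φ.T n), 0, ((1 + (Φ.Lmid n)) + ((Φ.N n) - f1)), 0, 0, 0] := by
  rw [childX_eval Φ (by norm_num)]; simp [chT]

/-! #### Tag 8: `BP(s,j,a,b)`: the `s`-part of `((AᵀA)^j) a b` (binary powering) -/

/-- Well-formedness of `BP`. [cite: KoiranPerifel2009VPSPACE, §3.2] -/
theorem wf_BP : WF Φ n len [8, s, f1, f2, f3, f4, f5, f6] ↔ (GWF Φ n len 8 s f1 f2 f3 f4 f5 f6 ∧ (f1 ≤ (2 * (Φ.N n)) ∧ (f2 < (Φ.N n) ∧ (f3 < (Φ.N n))))) := by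
  simp only [WF, WFt, List.getD_cons_zero, List.getD_cons_succ]

/-- The kind of `BP`. [cite: KoiranPerifel2009VPSPACE, §3.2] -/
theorem kind_BP (h : WF Φ n len [8, s, f1, f2, f3, f4, f5, f6]) : kindX.eval (aenv Φ.params n len [8, s, f1, f2, f3, f4, f5, f6]) = 1 := by
  rw [kindX, eval_cond_pos, if_pos ((wf_iff Φ ..).2 h), bytag_eval Φ _ (by norm_num)]; simp [kindT]

/-- The arity of `BP`. [cite: KoiranPerifel2009VPSPACE, §3.2] -/
theorem arity_BP (h : WF Φ n len [8, s, f1, f2, f3, f4, f5, f6]) : arityX.eval (aenv Φ.params n len [8, s, f1, f2, f3, f4, f5, f6]) = (if f1 = 0 then (if f2 = f3 ∧ (s = 0) then 1 else 0) else (if (f1 % 2) = 0 then 1 else (2 * (Φ.N n)))) := by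
  rw [arityX, eval_cond_pos, if_pos ((wf_iff Φ ..).2 h), bytag_eval Φ _ (by norm_num)]; simp [arityT]

/-- The depth of `BP`. [cite: KoiranPerifel2009VPSPACE, §3.2] -/
theorem depth_BP (h : WF Φ n len [8, s, f1, f2, f3, f4, f5, f6]) : depthX.eval (aenv Φ.params n len [8, s, f1, f2, f3, f4, f5, f6]) = ((4 * (Nat.size f1)) + 3) := by
  rw [depthX, eval_cond_pos, if_pos ((wf_iff Φ ..).2 h), bytag_eval Φ _ (by norm_num)]; simp [depthT]

/-- The children of `BP`. [cite: KoiranPerifel2009VPSPACE, §3.2] -/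
theorem child_BP (k : ℕ) : childX.map (AExp.eval (aenvK Φ.params n len [8, s, f1, f2, f3, f4, f5, f6] k)) = [(if f1 = 0 then 0 else (if (f1 % 2) = 0 then 9 else 11)), (if f1 = 0 then 0 else (if (f1 % 2) = 0 then s else s)), (if f1 = 0 then 0 else (if (f1 % 2) = 0 then f1 else f1)), (if f1 = 0 then 0 else (if (f1 % 2) = 0 then f2 else f2)), (if f1 = 0 then 0 else (if (f1 % 2) = 0 then f3 else f3)), (if f1 = 0 then 0 else (if (f1 % 2) = 0 then 0 else k)), (if f1 = 0 then 0 else (if (f1 % 2) = 0 then 0 else 0)), (if f1 = 0 then 0 else (if (f1 % 2) = 0 then 0 else 0))] := by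
  rw [childX_eval Φ (by norm_num)]; simp [chT]

/-! #### Tag 9: `SQ(s,j,a,b)`: the `s`-part of `((AᵀA)^{2⌊j/2⌋}) a b` -/

/-- Well-formedness of `SQ`. [cite: KoiranPerifel2009VPSPACE, §3.2] -/
theorem wf_SQ : WF Φ n len [9, s, f1, f2, f3, f4, f5, f6] ↔ (GWF Φ n len 9 s f1 f2 f3 f4 f5 f6 ∧ (0 < f1 ∧ (f1 ≤ (2 * (Φ.N n)) ∧ (f2 < (Φ.N n) ∧ (f3 < (Φ.N n)))))) := by
  simp only [WF, WFt, List.getD_cons_zero, List.getD_cons_succ]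

/-- The kind of `SQ`. [cite: KoiranPerifel2009VPSPACE, §3.2] -/
theorem kind_SQ (h : WF Φ n len [9, s, f1, f2, f3, f4, f5, f6]) : kindX.eval (aenv Φ.params n len [9, s, f1, f2, f3, f4, f5, f6]) = 1 := by
  rw [kindX, eval_cond_pos, if_pos ((wf_iff Φ ..).2 h), bytag_eval Φ _ (by norm_num)]; simp [kindT]

/-- The arity of `SQ`. [cite: KoiranPerifel2009VPSPACE, §3.2] -/
theorem arity_SQ (h : WF Φ n len [9, s, f1, f2, f3, f4, f5, f6]) : arityX.eval (aenv Φ.params n len [9, s, f1, f2, f3, f4, f5, f6]) = (2 * (Φ.N n)) := by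
  rw [arityX, eval_cond_pos, if_pos ((wf_iff Φ ..).2 h), bytag_eval Φ _ (by norm_num)]; simp [arityT]

/-- The depth of `SQ`. [cite: KoiranPerifel2009VPSPACE, §3.2] -/
theorem depth_SQ (h : WF Φ n len [9, s, f1, f2, f3, f4, f5, f6]) : depthX.eval (aenv Φ.params n len [9, s, f1, f2, f3, f4, f5, f6]) = ((4 * (Nat.size f1)) + 1) := by
  rw [depthX, eval_cond_pos, if_pos ((wf_iff Φ ..).2 h), bytag_eval Φ _ (by norm_num)]; simp [depthT]

/-- The children of `SQ`. [cite: KoiranPerifel2009VPSPACE, §3.2] -/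
theorem child_SQ (k : ℕ) : childX.map (AExp.eval (aenvK Φ.params n len [9, s, f1, f2, f3, f4, f5, f6] k)) = [10, s, f1, f2, f3, k, 0, 0] := by
  rw [childX_eval Φ (by norm_num)]; simp [chT]

/-! #### Tag 10: `PSQ(s,j,a,b,k)`: product for `SQ` -/

/-- Well-formedness of `PSQ`. [cite: KoiranPerifel2009VPSPACE, §3.2] -/
theorem wf_PSQ : WF Φ n len [10, s, f1, f2, f3, f4, f5, f6] ↔ (GWF Φ n len 10 s f1 f2 f3 f4 f5 f6 ∧ (0 < f1 ∧ (f1 ≤ (2 * (Φ.N n)) ∧ (f2 < (Φ.N n) ∧ (f3 < (Φ.N n) ∧ (f4 < (2 * (Φ.N n)))))))) := by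
  simp only [WF, WFt, List.getD_cons_zero, List.getD_cons_succ]

/-- The kind of `PSQ`. [cite: KoiranPerifel2009VPSPACE, §3.2] -/
theorem kind_PSQ (h : WF Φ n len [10, s, f1, f2, f3, f4, f5, f6]) : kindX.eval (aenv Φ.params n len [10, s, f1, f2, f3, f4, f5, f6]) = 2 := by
  rw [kindX, eval_cond_pos, if_pos ((wf_iff Φ ..).2 h), bytag_eval Φ _ (by norm_num)]; simp [kindT]

/-- The depth of `PSQ`. [cite: KoiranPerifel2009VPSPACE, §3.2] -/
theorem depth_PSQ (h : WF Φ n len [10, s, f1, f2, f3, f4, f5, f6]) : depthX.eval (aenv Φ.params n len [10, s, f1, f2, f3, f4, f5, f6]) = (4 * (Nat.size f1)) := by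
  rw [depthX, eval_cond_pos, if_pos ((wf_iff Φ ..).2 h), bytag_eval Φ _ (by norm_num)]; simp [depthT]

/-- Child `0` of `PSQ`. [cite: KoiranPerifel2009VPSPACE, §3.2] -/
theorem child_PSQ_0 : childX.map (AExp.eval (aenvK Φ.params n len [10, s, f1, f2, f3, f4, f5, f6] 0)) = [8, (f4 % 2), (f1 / 2), f2, (f4 / 2), 0, 0, 0] := by
  rw [childX_eval Φ (by norm_num)]; simp [chT]

/-- Child `1` of `PSQ`. [cite: KoiranPerifel2009VPSPACE, §3.2] -/
theorem child_PSQ_1 : childX.map (AExp.eval (aenvK Φ.params n len [10, s, f1, f2, f3, f4, f5, f6] 1)) = [8, (((f4 % 2) + s) % 2), (f1 / 2), (f4 / 2), f3, 0, 0, 0] := by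
  rw [childX_eval Φ (by norm_num)]; simp [chT]

/-! #### Tag 11: `PBP(s,j,a,b,k)`: product for odd `BP` -/

/-- Well-formedness of `PBP`. [cite: KoiranPerifel2009VPSPACE, §3.2] -/
theorem wf_PBP : WF Φ n len [11, s, f1, f2, f3, f4, f5, f6] ↔ (GWF Φ n len 11 s f1 f2 f3 f4 f5 f6 ∧ (0 < f1 ∧ (f1 ≤ (2 * (Φ.N n)) ∧ ((f1 % 2) = 1 ∧ (f2 < (Φ.N n) ∧ (f3 < (Φ.N n) ∧ (f4 < (2 * (Φ.N n))))))))) := by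
  simp only [WF, WFt, List.getD_cons_zero, List.getD_cons_succ]

/-- The kind of `PBP`. [cite: KoiranPerifel2009VPSPACE, §3.2] -/
theorem kind_PBP (h : WF Φ n len [11, s, f1, f2, f3, f4, f5, f6]) : kindX.eval (aenv Φ.params n len [11, s, f1, f2, f3, f4, f5, f6]) = 2 := by
  rw [kindX, eval_cond_pos, if_pos ((wf_iff Φ ..).2 h), bytag_eval Φ _ (by norm_num)]; simp [kindT]

/-- The depth of `PBP`. [cite: KoiranPerifel2009VPSPACE, §3.2] -/
theorem depth_PBP (h : WF Φ n len [11, s, f1, f2, f3, f4, f5, f6]) : depthX.eval (aenv Φ.params n len [11, s, f1, f2, f3, f4, f5, f6]) = ((4 * (Nat.size f1)) + 2) := by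
  rw [depthX, eval_cond_pos, if_pos ((wf_iff Φ ..).2 h), bytag_eval Φ _ (by norm_num)]; simp [depthT]

/-- Child `0` of `PBP`. [cite: KoiranPerifel2009VPSPACE, §3.2] -/
theorem child_PBP_0 : childX.map (AExp.eval (aenvK Φ.params n len [11, s, f1, f2, f3, f4, f5, f6] 0)) = [9, (f4 % 2), f1, f2, (f4 / 2), 0, 0, 0] := by
  rw [childX_eval Φ (by norm_num)]; simp [chT]

/-- Child `1` of `PBP`. [cite: KoiranPerifel2009VPSPACE, §3.2] -/
theorem child_PBP_1 : childX.map (AExp.eval (aenvK Φ.params n len [11, s, f1, f2, f3, f4, f5, f6] 1)) = [2, (((f4 % 2) + s) % 2), (f4 / 2), f3, 0, 0, 0, 0] := by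
  rw [childX_eval Φ (by norm_num)]; simp [chT]

/-! #### Tag 12: `CSQ(s,K)`: the `s`-part of `Σ_{i<K} c_i²` (zero iff `c_0 = … = c_{K-1} = 0`) -/

/-- Well-formedness of `CSQ`. [cite: KoiranPerifel2009VPSPACE, §3.2] -/
theorem wf_CSQ : WF Φ n len [12, s, f1, f2, f3, f4, f5, f6] ↔ (GWF Φ n len 12 s f1 f2 f3 f4 f5 f6 ∧ (f1 ≤ ((Φ.N n) + 1))) := by
  simp only [WF, WFt, List.getD_cons_zero, List.getD_cons_succ]

/-- The kind of `CSQ`. [cite: KoiranPerifel2009VPSPACE, §3.2] -/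
theorem kind_CSQ (h : WF Φ n len [12, s, f1, f2, f3, f4, f5, f6]) : kindX.eval (aenv Φ.params n len [12, s, f1, f2, f3, f4, f5, f6]) = 1 := by
  rw [kindX, eval_cond_pos, if_pos ((wf_iff Φ ..).2 h), bytag_eval Φ _ (by norm_num)]; simp [kindT]

/-- The arity of `CSQ`. [cite: KoiranPerifel2009VPSPACE, §3.2] -/
theorem arity_CSQ (h : WF Φ n len [12, s, f1, f2, f3, f4, f5, f6]) : arityX.eval (aenv Φ.params n len [12, s, f1, f2, f3, f4, f5, f6]) = (2 * f1) := by
  rw [arityX, eval_cond_pos, if_pos ((wf_iff Φ ..).2 h), bytag_eval Φ _ (by norm_num)]; simp [arityT]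

/-- The depth of `CSQ`. [cite: KoiranPerifel2009VPSPACE, §3.2] -/
theorem depth_CSQ (h : WF Φ n len [12, s, f1, f2, f3, f4, f5, f6]) : depthX.eval (aenv Φ.params n len [12, s, f1, f2, f3, f4, f5, f6]) = ((2 * (Φ.T n)) + 7) := by
  rw [depthX, eval_cond_pos, if_pos ((wf_iff Φ ..).2 h), bytag_eval Φ _ (by norm_num)]; simp [depthT]

/-- The children of `CSQ`. [cite: KoiranPerifel2009VPSPACE, §3.2] -/
theorem child_CSQ (k : ℕ) : childX.map (AExp.eval (aenvK Φ.params n len [12, s, f1, f2, f3, f4, f5, f6] k)) = [13, s, k, 0, 0, 0, 0, 0] := by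
  rw [childX_eval Φ (by norm_num)]; simp [chT]

/-! #### Tag 13: `PC(s,k)`: product for `CSQ` -/

/-- Well-formedness of `PC`. [cite: KoiranPerifel2009VPSPACE, §3.2] -/
theorem wf_PC : WF Φ n len [13, s, f1, f2, f3, f4, f5, f6] ↔ (GWF Φ n len 13 s f1 f2 f3 f4 f5 f6 ∧ (f1 < (2 * ((Φ.N n) + 1)))) := by
  simp only [WF, WFt, List.getD_cons_zero, List.getD_cons_succ]

/-- The kind of `PC`. [cite: KoiranPerifel2009VPSPACE, §3.2] -/
theorem kind_PC (h : WF Φ n len [13, s, f1, f2, f3, f4, f5, f6]) : kindX.eval (aenv Φ.params n len [13, s, f1, f2, f3, f4, f5, f6]) = 2 := by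
  rw [kindX, eval_cond_pos, if_pos ((wf_iff Φ ..).2 h), bytag_eval Φ _ (by norm_num)]; simp [kindT]

/-- The depth of `PC`. [cite: KoiranPerifel2009VPSPACE, §3.2] -/
theorem depth_PC (h : WF Φ n len [13, s, f1, f2, f3, f4, f5, f6]) : depthX.eval (aenv Φ.params n len [13, s, f1, f2, f3, f4, f5, f6]) = ((2 * (Φ.T n)) + 6) := by
  rw [depthX, eval_cond_pos, if_pos ((wf_iff Φ ..).2 h), bytag_eval Φ _ (by norm_num)]; simp [depthT]

/-- Child `0` of `PC`. [cite: KoiranPerifel2009VPSPACE, §3.2] -/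
theorem child_PC_0 : childX.map (AExp.eval (aenvK Φ.params n len [13, s, f1, f2, f3, f4, f5, f6] 0)) = [7, (f1 % 2), (f1 / 2), 0, 0, 0, 0, 0] := by
  rw [childX_eval Φ (by norm_num)]; simp [chT]

/-- Child `1` of `PC`. [cite: KoiranPerifel2009VPSPACE, §3.2] -/
theorem child_PC_1 : childX.map (AExp.eval (aenvK Φ.params n len [13, s, f1, f2, f3, f4, f5, f6] 1)) = [7, (((f1 % 2) + s) % 2), (f1 / 2), 0, 0, 0, 0, 0] := by
  rw [childX_eval Φ (by norm_num)]; simp [chT]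

/-! #### Tag 14: `QK(s,k',j,a,b)`: the `s`-part of `(Σ_{i≤N} c_{i+k'} (AᵀA)^{i+j}) a b` (= `q_B(B)B^j` when `k' = k_B`) -/

/-- Well-formedness of `QK`. [cite: KoiranPerifel2009VPSPACE, §3.2] -/
theorem wf_QK : WF Φ n len [14, s, f1, f2, f3, f4, f5, f6] ↔ (GWF Φ n len 14 s f1 f2 f3 f4 f5 f6 ∧ (f1 ≤ (Φ.N n) ∧ (f2 ≤ (Φ.N n) ∧ (f3 < (Φ.N n) ∧ (f4 < (Φ.N n)))))) := by
  simp only [WF, WFt, List.getD_cons_zero, List.getD_cons_succ]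

/-- The kind of `QK`. [cite: KoiranPerifel2009VPSPACE, §3.2] -/
theorem kind_QK (h : WF Φ n len [14, s, f1, f2, f3, f4, f5, f6]) : kindX.eval (aenv Φ.params n len [14, s, f1, f2, f3, f4, f5, f6]) = 1 := by
  rw [kindX, eval_cond_pos, if_pos ((wf_iff Φ ..).2 h), bytag_eval Φ _ (by norm_num)]; simp [kindT]

/-- The arity of `QK`. [cite: KoiranPerifel2009VPSPACE, §3.2] -/
theorem arity_QK (h : WF Φ n len [14, s, f1, f2, f3, f4, f5, f6]) : arityX.eval (aenv Φ.params n len [14, s, f1, f2, f3, f4, f5, f6]) = (2 * ((Φ.N n) + 1)) := by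
  rw [arityX, eval_cond_pos, if_pos ((wf_iff Φ ..).2 h), bytag_eval Φ _ (by norm_num)]; simp [arityT]

/-- The depth of `QK`. [cite: KoiranPerifel2009VPSPACE, §3.2] -/
theorem depth_QK (h : WF Φ n len [14, s, f1, f2, f3, f4, f5, f6]) : depthX.eval (aenv Φ.params n len [14, s, f1, f2, f3, f4, f5, f6]) = ((4 * (Φ.F n)) + 9) := by
  rw [depthX, eval_cond_pos, if_pos ((wf_iff Φ ..).2 h), bytag_eval Φ _ (by norm_num)]; simp [depthT]

/-- The children of `QK`. [cite: KoiranPerifel2009VPSPACE, §3.2] -/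
theorem child_QK (k : ℕ) : childX.map (AExp.eval (aenvK Φ.params n len [14, s, f1, f2, f3, f4, f5, f6] k)) = [15, s, f1, f2, f3, f4, k, 0] := by
  rw [childX_eval Φ (by norm_num)]; simp [chT]

/-! #### Tag 15: `PQK(s,k',j,a,b,k)`: product for `QK` -/

/-- Well-formedness of `PQK`. [cite: KoiranPerifel2009VPSPACE, §3.2] -/
theorem wf_PQK : WF Φ n len [15, s, f1, f2, f3, f4, f5, f6] ↔ (GWF Φ n len 15 s f1 f2 f3 f4 f5 f6 ∧ (f1 ≤ (Φ.N n) ∧ (f2 ≤ (Φ.N n) ∧ (f3 < (Φ.N n) ∧ (f4 < (Φ.N n) ∧ (f5 < (2 * ((Φ.N n) + 1)))))))) := by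
  simp only [WF, WFt, List.getD_cons_zero, List.getD_cons_succ]

/-- The kind of `PQK`. [cite: KoiranPerifel2009VPSPACE, §3.2] -/
theorem kind_PQK (h : WF Φ n len [15, s, f1, f2, f3, f4, f5, f6]) : kindX.eval (aenv Φ.params n len [15, s, f1, f2, f3, f4, f5, f6]) = 2 := by
  rw [kindX, eval_cond_pos, if_pos ((wf_iff Φ ..).2 h), bytag_eval Φ _ (by norm_num)]; simp [kindT]

/-- The depth of `PQK`. [cite: KoiranPerifel2009VPSPACE, §3.2] -/
theorem depth_PQK (h : WF Φ n len [15, s, f1, f2, f3, f4, f5, f6]) : depthX.eval (aenv Φ.params n len [15, s, f1, f2, f3, f4, f5, f6]) = ((4 * (Φ.F n)) + 8) := by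
  rw [depthX, eval_cond_pos, if_pos ((wf_iff Φ ..).2 h), bytag_eval Φ _ (by norm_num)]; simp [depthT]

/-- Child `0` of `PQK`. [cite: KoiranPerifel2009VPSPACE, §3.2] -/
theorem child_PQK_0 : childX.map (AExp.eval (aenvK Φ.params n len [15, s, f1, f2, f3, f4, f5, f6] 0)) = [7, (f5 % 2), ((f5 / 2) + f1), 0, 0, 0, 0, 0] := by
  rw [childX_eval Φ (by norm_num)]; simp [chT]

/-- Child `1` of `PQK`. [cite: KoiranPerifel2009VPSPACE, §3.2] -/
theorem child_PQK_1 : childX.map (AExp.eval (aenvK Φ.params n len [15, s, f1, f2, f3, f4, f5, f6] 1)) = [8, (((f5 % 2) + s) % 2), ((f5 / 2) + f2), f3, f4, 0, 0, 0] := by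
  rw [childX_eval Φ (by norm_num)]; simp [chT]

/-! #### Tag 16: `QT(s,k',j,a,b)`: `[c_0..c_{k'-1} = 0] · QT2` -/

/-- Well-formedness of `QT`. [cite: KoiranPerifel2009VPSPACE, §3.2] -/
theorem wf_QT : WF Φ n len [16, s, f1, f2, f3, f4, f5, f6] ↔ (GWF Φ n len 16 s f1 f2 f3 f4 f5 f6 ∧ (f1 ≤ (Φ.N n) ∧ (f2 ≤ (Φ.N n) ∧ (f3 < (Φ.N n) ∧ (f4 < (Φ.N n)))))) := by
  simp only [WF, WFt, List.getD_cons_zero, List.getD_cons_succ]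

/-- The kind of `QT`. [cite: KoiranPerifel2009VPSPACE, §3.2] -/
theorem kind_QT (h : WF Φ n len [16, s, f1, f2, f3, f4, f5, f6]) : kindX.eval (aenv Φ.params n len [16, s, f1, f2, f3, f4, f5, f6]) = 3 := by
  rw [kindX, eval_cond_pos, if_pos ((wf_iff Φ ..).2 h), bytag_eval Φ _ (by norm_num)]; simp [kindT]

/-- The width of `QT`. [cite: KoiranPerifel2009VPSPACE, §3.2] -/
theorem width_QT (h : WF Φ n len [16, s, f1, f2, f3, f4, f5, f6]) : widthX.eval (aenv Φ.params n len [16, s, f1, f2, f3, f4, f5, f6]) = (Φ.Wmux n) := by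
  rw [widthX, eval_cond_pos, if_pos ((wf_iff Φ ..).2 h), bytag_eval Φ _ (by norm_num)]; simp [widthT]

/-- The depth of `QT`. [cite: KoiranPerifel2009VPSPACE, §3.2] -/
theorem depth_QT (h : WF Φ n len [16, s, f1, f2, f3, f4, f5, f6]) : depthX.eval (aenv Φ.params n len [16, s, f1, f2, f3, f4, f5, f6]) = ((4 * (Φ.F n)) + 11) := by
  rw [depthX, eval_cond_pos, if_pos ((wf_iff Φ ..).2 h), bytag_eval Φ _ (by norm_num)]; simp [depthT]

/-- Child `0` of `QT`. [cite: KoiranPerifel2009VPSPACE, §3.2] -/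
theorem child_QT_0 : childX.map (AExp.eval (aenvK Φ.params n len [16, s, f1, f2, f3, f4, f5, f6] 0)) = [12, 0, f1, 0, 0, 0, 0, 0] := by
  rw [childX_eval Φ (by norm_num)]; simp [chT]

/-- Child `1` of `QT`. [cite: KoiranPerifel2009VPSPACE, §3.2] -/
theorem child_QT_1 : childX.map (AExp.eval (aenvK Φ.params n len [16, s, f1, f2, f3, f4, f5, f6] 1)) = [12, 1, f1, 0, 0, 0, 0, 0] := by
  rw [childX_eval Φ (by norm_num)]; simp [chT]

/-- Child `2` of `QT`. [cite: KoiranPerifel2009VPSPACE, §3.2] -/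
theorem child_QT_2 : childX.map (AExp.eval (aenvK Φ.params n len [16, s, f1, f2, f3, f4, f5, f6] 2)) = [17, s, f1, f2, f3, f4, 0, 0] := by
  rw [childX_eval Φ (by norm_num)]; simp [chT]

/-- Child `3` of `QT`. [cite: KoiranPerifel2009VPSPACE, §3.2] -/
theorem child_QT_3 : childX.map (AExp.eval (aenvK Φ.params n len [16, s, f1, f2, f3, f4, f5, f6] 3)) = [30, 0, 0, 0, 0, 0, 0, 0] := by
  rw [childX_eval Φ (by norm_num)]; simp [chT]

/-! #### Tag 17: `QT2(s,k',j,a,b)`: `[c_{k'} ≠ 0] · QK` -/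

/-- Well-formedness of `QT2`. [cite: KoiranPerifel2009VPSPACE, §3.2] -/
theorem wf_QT2 : WF Φ n len [17, s, f1, f2, f3, f4, f5, f6] ↔ (GWF Φ n len 17 s f1 f2 f3 f4 f5 f6 ∧ (f1 ≤ (Φ.N n) ∧ (f2 ≤ (Φ.N n) ∧ (f3 < (Φ.N n) ∧ (f4 < (Φ.N n)))))) := by
  simp only [WF, WFt, List.getD_cons_zero, List.getD_cons_succ]

/-- The kind of `QT2`. [cite: KoiranPerifel2009VPSPACE, §3.2] -/
theorem kind_QT2 (h : WF Φ n len [17, s, f1, f2, f3, f4, f5, f6]) : kindX.eval (aenv Φ.params n len [17, s, f1, f2, f3, f4, f5, f6]) = 3 := by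
  rw [kindX, eval_cond_pos, if_pos ((wf_iff Φ ..).2 h), bytag_eval Φ _ (by norm_num)]; simp [kindT]

/-- The width of `QT2`. [cite: KoiranPerifel2009VPSPACE, §3.2] -/
theorem width_QT2 (h : WF Φ n len [17, s, f1, f2, f3, f4, f5, f6]) : widthX.eval (aenv Φ.params n len [17, s, f1, f2, f3, f4, f5, f6]) = (Φ.Wmux n) := by
  rw [widthX, eval_cond_pos, if_pos ((wf_iff Φ ..).2 h), bytag_eval Φ _ (by norm_num)]; simp [widthT]

/-- The depth of `QT2`. [cite: KoiranPerifel2009VPSPACE, §3.2] -/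
theorem depth_QT2 (h : WF Φ n len [17, s, f1, f2, f3, f4, f5, f6]) : depthX.eval (aenv Φ.params n len [17, s, f1, f2, f3, f4, f5, f6]) = ((4 * (Φ.F n)) + 10) := by
  rw [depthX, eval_cond_pos, if_pos ((wf_iff Φ ..).2 h), bytag_eval Φ _ (by norm_num)]; simp [depthT]

/-- Child `0` of `QT2`. [cite: KoiranPerifel2009VPSPACE, §3.2] -/
theorem child_QT2_0 : childX.map (AExp.eval (aenvK Φ.params n len [17, s, f1, f2, f3, f4, f5, f6] 0)) = [7, 0, f1, 0, 0, 0, 0, 0] := by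
  rw [childX_eval Φ (by norm_num)]; simp [chT]

/-- Child `1` of `QT2`. [cite: KoiranPerifel2009VPSPACE, §3.2] -/
theorem child_QT2_1 : childX.map (AExp.eval (aenvK Φ.params n len [17, s, f1, f2, f3, f4, f5, f6] 1)) = [7, 1, f1, 0, 0, 0, 0, 0] := by
  rw [childX_eval Φ (by norm_num)]; simp [chT]

/-- Child `2` of `QT2`. [cite: KoiranPerifel2009VPSPACE, §3.2] -/
theorem child_QT2_2 : childX.map (AExp.eval (aenvK Φ.params n len [17, s, f1, f2, f3, f4, f5, f6] 2)) = [30, 0, 0, 0, 0, 0, 0, 0] := by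
  rw [childX_eval Φ (by norm_num)]; simp [chT]

/-- Child `3` of `QT2`. [cite: KoiranPerifel2009VPSPACE, §3.2] -/
theorem child_QT2_3 : childX.map (AExp.eval (aenvK Φ.params n len [17, s, f1, f2, f3, f4, f5, f6] 3)) = [14, s, f1, f2, f3, f4, 0, 0] := by
  rw [childX_eval Φ (by norm_num)]; simp [chT]

/-! #### Tag 18: `QB(s,j,a,b)`: the `s`-part of `(q_B(B)·B^j) a b`, `B = AᵀA` -/

/-- Well-formedness of `QB`. [cite: KoiranPerifel2009VPSPACE, §3.2] -/
theorem wf_QB : WF Φ n len [18, s, f1, f2, f3, f4, f5, f6] ↔ (GWF Φ n len 18 s f1 f2 f3 f4 f5 f6 ∧ (f1 ≤ (Φ.N n) ∧ (f2 < (Φ.N n) ∧ (f3 < (Φ.N n))))) := by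
  simp only [WF, WFt, List.getD_cons_zero, List.getD_cons_succ]

/-- The kind of `QB`. [cite: KoiranPerifel2009VPSPACE, §3.2] -/
theorem kind_QB (h : WF Φ n len [18, s, f1, f2, f3, f4, f5, f6]) : kindX.eval (aenv Φ.params n len [18, s, f1, f2, f3, f4, f5, f6]) = 1 := by
  rw [kindX, eval_cond_pos, if_pos ((wf_iff Φ ..).2 h), bytag_eval Φ _ (by norm_num)]; simp [kindT]

/-- The arity of `QB`. [cite: KoiranPerifel2009VPSPACE, §3.2] -/
theorem arity_QB (h : WF Φ n len [18, s, f1, f2, f3, f4, f5, f6]) : arityX.eval (aenv Φ.params n len [18, s, f1, f2, f3, f4, f5, f6]) = ((Φ.N n) + 1) := by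
  rw [arityX, eval_cond_pos, if_pos ((wf_iff Φ ..).2 h), bytag_eval Φ _ (by norm_num)]; simp [arityT]

/-- The depth of `QB`. [cite: KoiranPerifel2009VPSPACE, §3.2] -/
theorem depth_QB (h : WF Φ n len [18, s, f1, f2, f3, f4, f5, f6]) : depthX.eval (aenv Φ.params n len [18, s, f1, f2, f3, f4, f5, f6]) = ((4 * (Φ.F n)) + 12) := by
  rw [depthX, eval_cond_pos, if_pos ((wf_iff Φ ..).2 h), bytag_eval Φ _ (by norm_num)]; simp [depthT]

/-- The children of `QB`. [cite: KoiranPerifel2009VPSPACE, §3.2] -/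
theorem child_QB (k : ℕ) : childX.map (AExp.eval (aenvK Φ.params n len [18, s, f1, f2, f3, f4, f5, f6] k)) = [16, s, k, f1, f2, f3, 0, 0] := by
  rw [childX_eval Φ (by norm_num)]; simp [chT]

/-! #### Tag 19: `QSQ(s,j)`: the `s`-part of `Σ_{a,b} ((q_B(B)B^j) a b)²` (zero iff `q_B(B)B^j = 0`) -/

/-- Well-formedness of `QSQ`. [cite: KoiranPerifel2009VPSPACE, §3.2] -/
theorem wf_QSQ : WF Φ n len [19, s, f1, f2, f3, f4, f5, f6] ↔ (GWF Φ n len 19 s f1 f2 f3 f4 f5 f6 ∧ (f1 ≤ (Φ.N n))) := by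
  simp only [WF, WFt, List.getD_cons_zero, List.getD_cons_succ]

/-- The kind of `QSQ`. [cite: KoiranPerifel2009VPSPACE, §3.2] -/
theorem kind_QSQ (h : WF Φ n len [19, s, f1, f2, f3, f4, f5, f6]) : kindX.eval (aenv Φ.params n len [19, s, f1, f2, f3, f4, f5, f6]) = 1 := by
  rw [kindX, eval_cond_pos, if_pos ((wf_iff Φ ..).2 h), bytag_eval Φ _ (by norm_num)]; simp [kindT]

/-- The arity of `QSQ`. [cite: KoiranPerifel2009VPSPACE, §3.2] -/
theorem arity_QSQ (h : WF Φ n len [19, s, f1, f2, f3, f4, f5, f6]) : arityX.eval (aenv Φ.params n len [19, s, f1, f2, f3, f4, f5, f6]) = (2 * ((Φ.N n) * (Φ.N n))) := by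
  rw [arityX, eval_cond_pos, if_pos ((wf_iff Φ ..).2 h), bytag_eval Φ _ (by norm_num)]; simp [arityT]

/-- The depth of `QSQ`. [cite: KoiranPerifel2009VPSPACE, §3.2] -/
theorem depth_QSQ (h : WF Φ n len [19, s, f1, f2, f3, f4, f5, f6]) : depthX.eval (aenv Φ.params n len [19, s, f1, f2, f3, f4, f5, f6]) = ((4 * (Φ.F n)) + 14) := by
  rw [depthX, eval_cond_pos, if_pos ((wf_iff Φ ..).2 h), bytag_eval Φ _ (by norm_num)]; simp [depthT]

/-- The children of `QSQ`. [cite: KoiranPerifel2009VPSPACE, §3.2] -/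
theorem child_QSQ (k : ℕ) : childX.map (AExp.eval (aenvK Φ.params n len [19, s, f1, f2, f3, f4, f5, f6] k)) = [20, s, f1, k, 0, 0, 0, 0] := by
  rw [childX_eval Φ (by norm_num)]; simp [chT]

/-! #### Tag 20: `PQ(s,j,k)`: product for `QSQ` -/

/-- Well-formedness of `PQ`. [cite: KoiranPerifel2009VPSPACE, §3.2] -/
theorem wf_PQ : WF Φ n len [20, s, f1, f2, f3, f4, f5, f6] ↔ (GWF Φ n len 20 s f1 f2 f3 f4 f5 f6 ∧ (f1 ≤ (Φ.N n) ∧ (f2 < (2 * ((Φ.N n) * (Φ.N n)))))) := by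
  simp only [WF, WFt, List.getD_cons_zero, List.getD_cons_succ]

/-- The kind of `PQ`. [cite: KoiranPerifel2009VPSPACE, §3.2] -/
theorem kind_PQ (h : WF Φ n len [20, s, f1, f2, f3, f4, f5, f6]) : kindX.eval (aenv Φ.params n len [20, s, f1, f2, f3, f4, f5, f6]) = 2 := by
  rw [kindX, eval_cond_pos, if_pos ((wf_iff Φ ..).2 h), bytag_eval Φ _ (by norm_num)]; simp [kindT]

/-- The depth of `PQ`. [cite: KoiranPerifel2009VPSPACE, §3.2] -/
theorem depth_PQ (h : WF Φ n len [20, s, f1, f2, f3, f4, f5, f6]) : depthX.eval (aenv Φ.params n len [20, s, f1, f2, f3, f4, f5, f6]) = ((4 * (Φ.F n)) + 13) := by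
  rw [depthX, eval_cond_pos, if_pos ((wf_iff Φ ..).2 h), bytag_eval Φ _ (by norm_num)]; simp [depthT]

/-- Child `0` of `PQ`. [cite: KoiranPerifel2009VPSPACE, §3.2] -/
theorem child_PQ_0 : childX.map (AExp.eval (aenvK Φ.params n len [20, s, f1, f2, f3, f4, f5, f6] 0)) = [18, (f2 % 2), f1, ((f2 / 2) / (Φ.N n)), ((f2 / 2) % (Φ.N n)), 0, 0, 0] := by
  rw [childX_eval Φ (by norm_num)]; simp [chT]

/-- Child `1` of `PQ`. [cite: KoiranPerifel2009VPSPACE, §3.2] -/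
theorem child_PQ_1 : childX.map (AExp.eval (aenvK Φ.params n len [20, s, f1, f2, f3, f4, f5, f6] 1)) = [18, (((f2 % 2) + s) % 2), f1, ((f2 / 2) / (Φ.N n)), ((f2 / 2) % (Φ.N n)), 0, 0, 0] := by
  rw [childX_eval Φ (by norm_num)]; simp [chT]

/-! #### Tag 21: `NT(s,j',a,b)`: `[q_B(B)B^{j'+1} = 0] · NT2` -/

/-- Well-formedness of `NT`. [cite: KoiranPerifel2009VPSPACE, §3.2] -/
theorem wf_NT : WF Φ n len [21, s, f1, f2, f3, f4, f5, f6] ↔ (GWF Φ n len 21 s f1 f2 f3 f4 f5 f6 ∧ (f1 < (Φ.N n) ∧ (f2 < (Φ.N n) ∧ (f3 < (Φ.N n))))) := by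
  simp only [WF, WFt, List.getD_cons_zero, List.getD_cons_succ]

/-- The kind of `NT`. [cite: KoiranPerifel2009VPSPACE, §3.2] -/
theorem kind_NT (h : WF Φ n len [21, s, f1, f2, f3, f4, f5, f6]) : kindX.eval (aenv Φ.params n len [21, s, f1, f2, f3, f4, f5, f6]) = 3 := by
  rw [kindX, eval_cond_pos, if_pos ((wf_iff Φ ..).2 h), bytag_eval Φ _ (by norm_num)]; simp [kindT]

/-- The width of `NT`. [cite: KoiranPerifel2009VPSPACE, §3.2] -/
theorem width_NT (h : WF Φ n len [21, s, f1, f2, f3, f4, f5, f6]) : widthX.eval (aenv Φ.params n len [21, s, f1, f2, f3, f4, f5, f6]) = (Φ.Wmux n) := by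
  rw [widthX, eval_cond_pos, if_pos ((wf_iff Φ ..).2 h), bytag_eval Φ _ (by norm_num)]; simp [widthT]

/-- The depth of `NT`. [cite: KoiranPerifel2009VPSPACE, §3.2] -/
theorem depth_NT (h : WF Φ n len [21, s, f1, f2, f3, f4, f5, f6]) : depthX.eval (aenv Φ.params n len [21, s, f1, f2, f3, f4, f5, f6]) = ((4 * (Φ.F n)) + 16) := by
  rw [depthX, eval_cond_pos, if_pos ((wf_iff Φ ..).2 h), bytag_eval Φ _ (by norm_num)]; simp [depthT]

/-- Child `0` of `NT`. [cite: KoiranPerifel2009VPSPACE, §3.2] -/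
theorem child_NT_0 : childX.map (AExp.eval (aenvK Φ.params n len [21, s, f1, f2, f3, f4, f5, f6] 0)) = [19, 0, (f1 + 1), 0, 0, 0, 0, 0] := by
  rw [childX_eval Φ (by norm_num)]; simp [chT]

/-- Child `1` of `NT`. [cite: KoiranPerifel2009VPSPACE, §3.2] -/
theorem child_NT_1 : childX.map (AExp.eval (aenvK Φ.params n len [21, s, f1, f2, f3, f4, f5, f6] 1)) = [19, 1, (f1 + 1), 0, 0, 0, 0, 0] := by
  rw [childX_eval Φ (by norm_num)]; simp [chT]

/-- Child `2` of `NT`. [cite: KoiranPerifel2009VPSPACE, §3.2] -/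
theorem child_NT_2 : childX.map (AExp.eval (aenvK Φ.params n len [21, s, f1, f2, f3, f4, f5, f6] 2)) = [22, s, f1, f2, f3, 0, 0, 0] := by
  rw [childX_eval Φ (by norm_num)]; simp [chT]

/-- Child `3` of `NT`. [cite: KoiranPerifel2009VPSPACE, §3.2] -/
theorem child_NT_3 : childX.map (AExp.eval (aenvK Φ.params n len [21, s, f1, f2, f3, f4, f5, f6] 3)) = [30, 0, 0, 0, 0, 0, 0, 0] := by
  rw [childX_eval Φ (by norm_num)]; simp [chT]

/-! #### Tag 22: `NT2(s,j',a,b)`: `[q_B(B)B^{j'} ≠ 0] · QB(j')` -/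

/-- Well-formedness of `NT2`. [cite: KoiranPerifel2009VPSPACE, §3.2] -/
theorem wf_NT2 : WF Φ n len [22, s, f1, f2, f3, f4, f5, f6] ↔ (GWF Φ n len 22 s f1 f2 f3 f4 f5 f6 ∧ (f1 < (Φ.N n) ∧ (f2 < (Φ.N n) ∧ (f3 < (Φ.N n))))) := by
  simp only [WF, WFt, List.getD_cons_zero, List.getD_cons_succ]

/-- The kind of `NT2`. [cite: KoiranPerifel2009VPSPACE, §3.2] -/
theorem kind_NT2 (h : WF Φ n len [22, s, f1, f2, f3, f4, f5, f6]) : kindX.eval (aenv Φ.params n len [22, s, f1, f2, f3, f4, f5, f6]) = 3 := by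
  rw [kindX, eval_cond_pos, if_pos ((wf_iff Φ ..).2 h), bytag_eval Φ _ (by norm_num)]; simp [kindT]

/-- The width of `NT2`. [cite: KoiranPerifel2009VPSPACE, §3.2] -/
theorem width_NT2 (h : WF Φ n len [22, s, f1, f2, f3, f4, f5, f6]) : widthX.eval (aenv Φ.params n len [22, s, f1, f2, f3, f4, f5, f6]) = (Φ.Wmux n) := by
  rw [widthX, eval_cond_pos, if_pos ((wf_iff Φ ..).2 h), bytag_eval Φ _ (by norm_num)]; simp [widthT]

/-- The depth of `NT2`. [cite: KoiranPerifel2009VPSPACE, §3.2] -/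
theorem depth_NT2 (h : WF Φ n len [22, s, f1, f2, f3, f4, f5, f6]) : depthX.eval (aenv Φ.params n len [22, s, f1, f2, f3, f4, f5, f6]) = ((4 * (Φ.F n)) + 15) := by
  rw [depthX, eval_cond_pos, if_pos ((wf_iff Φ ..).2 h), bytag_eval Φ _ (by norm_num)]; simp [depthT]

/-- Child `0` of `NT2`. [cite: KoiranPerifel2009VPSPACE, §3.2] -/
theorem child_NT2_0 : childX.map (AExp.eval (aenvK Φ.params n len [22, s, f1, f2, f3, f4, f5, f6] 0)) = [19, 0, f1, 0, 0, 0, 0, 0] := by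
  rw [childX_eval Φ (by norm_num)]; simp [chT]

/-- Child `1` of `NT2`. [cite: KoiranPerifel2009VPSPACE, §3.2] -/
theorem child_NT2_1 : childX.map (AExp.eval (aenvK Φ.params n len [22, s, f1, f2, f3, f4, f5, f6] 1)) = [19, 1, f1, 0, 0, 0, 0, 0] := by
  rw [childX_eval Φ (by norm_num)]; simp [chT]

/-- Child `2` of `NT2`. [cite: KoiranPerifel2009VPSPACE, §3.2] -/
theorem child_NT2_2 : childX.map (AExp.eval (aenvK Φ.params n len [22, s, f1, f2, f3, f4, f5, f6] 2)) = [30, 0, 0, 0, 0, 0, 0, 0] := by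
  rw [childX_eval Φ (by norm_num)]; simp [chT]

/-- Child `3` of `NT2`. [cite: KoiranPerifel2009VPSPACE, §3.2] -/
theorem child_NT2_3 : childX.map (AExp.eval (aenvK Φ.params n len [22, s, f1, f2, f3, f4, f5, f6] 3)) = [18, s, f1, f2, f3, 0, 0, 0] := by
  rw [childX_eval Φ (by norm_num)]; simp [chT]

/-! #### Tag 23: `NB(s,a,b)`: the `s`-part of the kernel matrix `N_B a b = (q_B(B)B^{j₀-1}) a b` -/

/-- Well-formedness of `NB`. [cite: KoiranPerifel2009VPSPACE, §3.2] -/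
theorem wf_NB : WF Φ n len [23, s, f1, f2, f3, f4, f5, f6] ↔ (GWF Φ n len 23 s f1 f2 f3 f4 f5 f6 ∧ (f1 < (Φ.N n) ∧ (f2 < (Φ.N n)))) := by
  simp only [WF, WFt, List.getD_cons_zero, List.getD_cons_succ]

/-- The kind of `NB`. [cite: KoiranPerifel2009VPSPACE, §3.2] -/
theorem kind_NB (h : WF Φ n len [23, s, f1, f2, f3, f4, f5, f6]) : kindX.eval (aenv Φ.params n len [23, s, f1, f2, f3, f4, f5, f6]) = 1 := by
  rw [kindX, eval_cond_pos, if_pos ((wf_iff Φ ..).2 h), bytag_eval Φ _ (by norm_num)]; simp [kindT]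

/-- The arity of `NB`. [cite: KoiranPerifel2009VPSPACE, §3.2] -/
theorem arity_NB (h : WF Φ n len [23, s, f1, f2, f3, f4, f5, f6]) : arityX.eval (aenv Φ.params n len [23, s, f1, f2, f3, f4, f5, f6]) = (Φ.N n) := by
  rw [arityX, eval_cond_pos, if_pos ((wf_iff Φ ..).2 h), bytag_eval Φ _ (by norm_num)]; simp [arityT]

/-- The depth of `NB`. [cite: KoiranPerifel2009VPSPACE, §3.2] -/
theorem depth_NB (h : WF Φ n len [23, s, f1, f2, f3, f4, f5, f6]) : depthX.eval (aenv Φ.params n len [23, s, f1, f2, f3, f4, f5, f6]) = ((4 * (Φ.F n)) + 17) := by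
  rw [depthX, eval_cond_pos, if_pos ((wf_iff Φ ..).2 h), bytag_eval Φ _ (by norm_num)]; simp [depthT]

/-- The children of `NB`. [cite: KoiranPerifel2009VPSPACE, §3.2] -/
theorem child_NB (k : ℕ) : childX.map (AExp.eval (aenvK Φ.params n len [23, s, f1, f2, f3, f4, f5, f6] k)) = [21, s, k, f1, f2, 0, 0, 0] := by
  rw [childX_eval Φ (by norm_num)]; simp [chT]

/-! #### Tag 24: `COLSQ(s,c)`: the `s`-part of `Σ_r (N_B r c)²` (zero iff column `c` of `N_B` vanishes) -/

/-- Well-formedness of `COLSQ`. [cite: KoiranPerifel2009VPSPACE, §3.2] -/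
theorem wf_COLSQ : WF Φ n len [24, s, f1, f2, f3, f4, f5, f6] ↔ (GWF Φ n len 24 s f1 f2 f3 f4 f5 f6 ∧ (f1 < (Φ.N n))) := by
  simp only [WF, WFt, List.getD_cons_zero, List.getD_cons_succ]

/-- The kind of `COLSQ`. [cite: KoiranPerifel2009VPSPACE, §3.2] -/
theorem kind_COLSQ (h : WF Φ n len [24, s, f1, f2, f3, f4, f5, f6]) : kindX.eval (aenv Φ.params n len [24, s, f1, f2, f3, f4, f5, f6]) = 1 := by
  rw [kindX, eval_cond_pos, if_pos ((wf_iff Φ ..).2 h), bytag_eval Φ _ (by norm_num)]; simp [kindT]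

/-- The arity of `COLSQ`. [cite: KoiranPerifel2009VPSPACE, §3.2] -/
theorem arity_COLSQ (h : WF Φ n len [24, s, f1, f2, f3, f4, f5, f6]) : arityX.eval (aenv Φ.params n len [24, s, f1, f2, f3, f4, f5, f6]) = (2 * (Φ.N n)) := by
  rw [arityX, eval_cond_pos, if_pos ((wf_iff Φ ..).2 h), bytag_eval Φ _ (by norm_num)]; simp [arityT]

/-- The depth of `COLSQ`. [cite: KoiranPerifel2009VPSPACE, §3.2] -/
theorem depth_COLSQ (h : WF Φ n len [24, s, f1, f2, f3, f4, f5, f6]) : depthX.eval (aenv Φ.params n len [24, s, f1, f2, f3, f4, f5, f6]) = ((4 * (Φ.F n)) + 19) := by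
  rw [depthX, eval_cond_pos, if_pos ((wf_iff Φ ..).2 h), bytag_eval Φ _ (by norm_num)]; simp [depthT]

/-- The children of `COLSQ`. [cite: KoiranPerifel2009VPSPACE, §3.2] -/
theorem child_COLSQ (k : ℕ) : childX.map (AExp.eval (aenvK Φ.params n len [24, s, f1, f2, f3, f4, f5, f6] k)) = [25, s, f1, k, 0, 0, 0, 0] := by
  rw [childX_eval Φ (by norm_num)]; simp [chT]

/-! #### Tag 25: `PN(s,c,k)`: product for `COLSQ` -/

/-- Well-formedness of `PN`. [cite: KoiranPerifel2009VPSPACE, §3.2] -/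
theorem wf_PN : WF Φ n len [25, s, f1, f2, f3, f4, f5, f6] ↔ (GWF Φ n len 25 s f1 f2 f3 f4 f5 f6 ∧ (f1 < (Φ.N n) ∧ (f2 < (2 * (Φ.N n))))) := by
  simp only [WF, WFt, List.getD_cons_zero, List.getD_cons_succ]

/-- The kind of `PN`. [cite: KoiranPerifel2009VPSPACE, §3.2] -/
theorem kind_PN (h : WF Φ n len [25, s, f1, f2, f3, f4, f5, f6]) : kindX.eval (aenv Φ.params n len [25, s, f1, f2, f3, f4, f5, f6]) = 2 := by
  rw [kindX, eval_cond_pos, if_pos ((wf_iff Φ ..).2 h), bytag_eval Φ _ (by norm_num)]; simp [kindT]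

/-- The depth of `PN`. [cite: KoiranPerifel2009VPSPACE, §3.2] -/
theorem depth_PN (h : WF Φ n len [25, s, f1, f2, f3, f4, f5, f6]) : depthX.eval (aenv Φ.params n len [25, s, f1, f2, f3, f4, f5, f6]) = ((4 * (Φ.F n)) + 18) := by
  rw [depthX, eval_cond_pos, if_pos ((wf_iff Φ ..).2 h), bytag_eval Φ _ (by norm_num)]; simp [depthT]

/-- Child `0` of `PN`. [cite: KoiranPerifel2009VPSPACE, §3.2] -/
theorem child_PN_0 : childX.map (AExp.eval (aenvK Φ.params n len [25, s, f1, f2, f3, f4, f5, f6] 0)) = [23, (f2 % 2), (f2 / 2), f1, 0, 0, 0, 0] := by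
  rw [childX_eval Φ (by norm_num)]; simp [chT]

/-- Child `1` of `PN`. [cite: KoiranPerifel2009VPSPACE, §3.2] -/
theorem child_PN_1 : childX.map (AExp.eval (aenvK Φ.params n len [25, s, f1, f2, f3, f4, f5, f6] 1)) = [23, (((f2 % 2) + s) % 2), (f2 / 2), f1, 0, 0, 0, 0] := by
  rw [childX_eval Φ (by norm_num)]; simp [chT]

/-! #### Tag 26: `PRE(s,c)`: the `s`-part of `Σ_{c'<c} Σ_r (N_B r c')²` (zero iff all columns before `c` vanish) -/

/-- Well-formedness of `PRE`. [cite: KoiranPerifel2009VPSPACE, §3.2] -/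
theorem wf_PRE : WF Φ n len [26, s, f1, f2, f3, f4, f5, f6] ↔ (GWF Φ n len 26 s f1 f2 f3 f4 f5 f6 ∧ (f1 ≤ (Φ.N n))) := by
  simp only [WF, WFt, List.getD_cons_zero, List.getD_cons_succ]

/-- The kind of `PRE`. [cite: KoiranPerifel2009VPSPACE, §3.2] -/
theorem kind_PRE (h : WF Φ n len [26, s, f1, f2, f3, f4, f5, f6]) : kindX.eval (aenv Φ.params n len [26, s, f1, f2, f3, f4, f5, f6]) = 1 := by
  rw [kindX, eval_cond_pos, if_pos ((wf_iff Φ ..).2 h), bytag_eval Φ _ (by norm_num)]; simp [kindT]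

/-- The arity of `PRE`. [cite: KoiranPerifel2009VPSPACE, §3.2] -/
theorem arity_PRE (h : WF Φ n len [26, s, f1, f2, f3, f4, f5, f6]) : arityX.eval (aenv Φ.params n len [26, s, f1, f2, f3, f4, f5, f6]) = f1 := by
  rw [arityX, eval_cond_pos, if_pos ((wf_iff Φ ..).2 h), bytag_eval Φ _ (by norm_num)]; simp [arityT]

/-- The depth of `PRE`. [cite: KoiranPerifel2009VPSPACE, §3.2] -/
theorem depth_PRE (h : WF Φ n len [26, s, f1, f2, f3, f4, f5, f6]) : depthX.eval (aenv Φ.params n len [26, s, f1, f2, f3, f4, f5, f6]) = ((4 * (Φ.F n)) + 20) := by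
  rw [depthX, eval_cond_pos, if_pos ((wf_iff Φ ..).2 h), bytag_eval Φ _ (by norm_num)]; simp [depthT]

/-- The children of `PRE`. [cite: KoiranPerifel2009VPSPACE, §3.2] -/
theorem child_PRE (k : ℕ) : childX.map (AExp.eval (aenvK Φ.params n len [26, s, f1, f2, f3, f4, f5, f6] k)) = [24, s, k, 0, 0, 0, 0, 0] := by
  rw [childX_eval Φ (by norm_num)]; simp [chT]

/-! #### Tag 27: `VT(s,c,r)`: `[columns before c vanish] · VT2` -/

/-- Well-formedness of `VT`. [cite: KoiranPerifel2009VPSPACE, §3.2] -/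
theorem wf_VT : WF Φ n len [27, s, f1, f2, f3, f4, f5, f6] ↔ (GWF Φ n len 27 s f1 f2 f3 f4 f5 f6 ∧ (f1 < (Φ.N n) ∧ (f2 < (Φ.N n)))) := by
  simp only [WF, WFt, List.getD_cons_zero, List.getD_cons_succ]

/-- The kind of `VT`. [cite: KoiranPerifel2009VPSPACE, §3.2] -/
theorem kind_VT (h : WF Φ n len [27, s, f1, f2, f3, f4, f5, f6]) : kindX.eval (aenv Φ.params n len [27, s, f1, f2, f3, f4, f5, f6]) = 3 := by
  rw [kindX, eval_cond_pos, if_pos ((wf_iff Φ ..).2 h), bytag_eval Φ _ (by norm_num)]; simp [kindT]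

/-- The width of `VT`. [cite: KoiranPerifel2009VPSPACE, §3.2] -/
theorem width_VT (h : WF Φ n len [27, s, f1, f2, f3, f4, f5, f6]) : widthX.eval (aenv Φ.params n len [27, s, f1, f2, f3, f4, f5, f6]) = (Φ.Wmux n) := by
  rw [widthX, eval_cond_pos, if_pos ((wf_iff Φ ..).2 h), bytag_eval Φ _ (by norm_num)]; simp [widthT]

/-- The depth of `VT`. [cite: KoiranPerifel2009VPSPACE, §3.2] -/
theorem depth_VT (h : WF Φ n len [27, s, f1, f2, f3, f4, f5, f6]) : depthX.eval (aenv Φ.params n len [27, s, f1, f2, f3, f4, f5, f6]) = ((4 * (Φ.F n)) + 21) := by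
  rw [depthX, eval_cond_pos, if_pos ((wf_iff Φ ..).2 h), bytag_eval Φ _ (by norm_num)]; simp [depthT]

/-- Child `0` of `VT`. [cite: KoiranPerifel2009VPSPACE, §3.2] -/
theorem child_VT_0 : childX.map (AExp.eval (aenvK Φ.params n len [27, s, f1, f2, f3, f4, f5, f6] 0)) = [26, 0, f1, 0, 0, 0, 0, 0] := by
  rw [childX_eval Φ (by norm_num)]; simp [chT]

/-- Child `1` of `VT`. [cite: KoiranPerifel2009VPSPACE, §3.2] -/
theorem child_VT_1 : childX.map (AExp.eval (aenvK Φ.params n len [27, s, f1, f2, f3, f4, f5, f6] 1)) = [26, 1, f1, 0, 0, 0, 0, 0] := by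
  rw [childX_eval Φ (by norm_num)]; simp [chT]

/-- Child `2` of `VT`. [cite: KoiranPerifel2009VPSPACE, §3.2] -/
theorem child_VT_2 : childX.map (AExp.eval (aenvK Φ.params n len [27, s, f1, f2, f3, f4, f5, f6] 2)) = [28, s, f1, f2, 0, 0, 0, 0] := by
  rw [childX_eval Φ (by norm_num)]; simp [chT]

/-- Child `3` of `VT`. [cite: KoiranPerifel2009VPSPACE, §3.2] -/
theorem child_VT_3 : childX.map (AExp.eval (aenvK Φ.params n len [27, s, f1, f2, f3, f4, f5, f6] 3)) = [30, 0, 0, 0, 0, 0, 0, 0] := by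
  rw [childX_eval Φ (by norm_num)]; simp [chT]

/-! #### Tag 28: `VT2(s,c,r)`: `[column c ≠ 0] · N_B r c` -/

/-- Well-formedness of `VT2`. [cite: KoiranPerifel2009VPSPACE, §3.2] -/
theorem wf_VT2 : WF Φ n len [28, s, f1, f2, f3, f4, f5, f6] ↔ (GWF Φ n len 28 s f1 f2 f3 f4 f5 f6 ∧ (f1 < (Φ.N n) ∧ (f2 < (Φ.N n)))) := by
  simp only [WF, WFt, List.getD_cons_zero, List.getD_cons_succ]

/-- The kind of `VT2`. [cite: KoiranPerifel2009VPSPACE, §3.2] -/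
theorem kind_VT2 (h : WF Φ n len [28, s, f1, f2, f3, f4, f5, f6]) : kindX.eval (aenv Φ.params n len [28, s, f1, f2, f3, f4, f5, f6]) = 3 := by
  rw [kindX, eval_cond_pos, if_pos ((wf_iff Φ ..).2 h), bytag_eval Φ _ (by norm_num)]; simp [kindT]

/-- The width of `VT2`. [cite: KoiranPerifel2009VPSPACE, §3.2] -/
theorem width_VT2 (h : WF Φ n len [28, s, f1, f2, f3, f4, f5, f6]) : widthX.eval (aenv Φ.params n len [28, s, f1, f2, f3, f4, f5, f6]) = (Φ.Wmux n) := by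
  rw [widthX, eval_cond_pos, if_pos ((wf_iff Φ ..).2 h), bytag_eval Φ _ (by norm_num)]; simp [widthT]

/-- The depth of `VT2`. [cite: KoiranPerifel2009VPSPACE, §3.2] -/
theorem depth_VT2 (h : WF Φ n len [28, s, f1, f2, f3, f4, f5, f6]) : depthX.eval (aenv Φ.params n len [28, s, f1, f2, f3, f4, f5, f6]) = ((4 * (Φ.F n)) + 20) := by
  rw [depthX, eval_cond_pos, if_pos ((wf_iff Φ ..).2 h), bytag_eval Φ _ (by norm_num)]; simp [depthT]

/-- Child `0` of `VT2`. [cite: KoiranPerifel2009VPSPACE, §3.2] -/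
theorem child_VT2_0 : childX.map (AExp.eval (aenvK Φ.params n len [28, s, f1, f2, f3, f4, f5, f6] 0)) = [24, 0, f1, 0, 0, 0, 0, 0] := by
  rw [childX_eval Φ (by norm_num)]; simp [chT]

/-- Child `1` of `VT2`. [cite: KoiranPerifel2009VPSPACE, §3.2] -/
theorem child_VT2_1 : childX.map (AExp.eval (aenvK Φ.params n len [28, s, f1, f2, f3, f4, f5, f6] 1)) = [24, 1, f1, 0, 0, 0, 0, 0] := by
  rw [childX_eval Φ (by norm_num)]; simp [chT]

/-- Child `2` of `VT2`. [cite: KoiranPerifel2009VPSPACE, §3.2] -/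
theorem child_VT2_2 : childX.map (AExp.eval (aenvK Φ.params n len [28, s, f1, f2, f3, f4, f5, f6] 2)) = [30, 0, 0, 0, 0, 0, 0, 0] := by
  rw [childX_eval Φ (by norm_num)]; simp [chT]

/-- Child `3` of `VT2`. [cite: KoiranPerifel2009VPSPACE, §3.2] -/
theorem child_VT2_3 : childX.map (AExp.eval (aenvK Φ.params n len [28, s, f1, f2, f3, f4, f5, f6] 3)) = [23, s, f2, f1, 0, 0, 0, 0] := by
  rw [childX_eval Φ (by norm_num)]; simp [chT]

/-! #### Tag 29: `V(s,r)`: the `s`-part of entry `r` of the canonical kernel vector `charpolyKernelVector (AᵀA)` -/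

/-- Well-formedness of `V`. [cite: KoiranPerifel2009VPSPACE, §3.2] -/
theorem wf_V : WF Φ n len [29, s, f1, f2, f3, f4, f5, f6] ↔ (GWF Φ n len 29 s f1 f2 f3 f4 f5 f6 ∧ (f1 < (Φ.N n))) := by
  simp only [WF, WFt, List.getD_cons_zero, List.getD_cons_succ]

/-- The kind of `V`. [cite: KoiranPerifel2009VPSPACE, §3.2] -/
theorem kind_V (h : WF Φ n len [29, s, f1, f2, f3, f4, f5, f6]) : kindX.eval (aenv Φ.params n len [29, s, f1, f2, f3, f4, f5, f6]) = 1 := by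
  rw [kindX, eval_cond_pos, if_pos ((wf_iff Φ ..).2 h), bytag_eval Φ _ (by norm_num)]; simp [kindT]

/-- The arity of `V`. [cite: KoiranPerifel2009VPSPACE, §3.2] -/
theorem arity_V (h : WF Φ n len [29, s, f1, f2, f3, f4, f5, f6]) : arityX.eval (aenv Φ.params n len [29, s, f1, f2, f3, f4, f5, f6]) = (Φ.N n) := by
  rw [arityX, eval_cond_pos, if_pos ((wf_iff Φ ..).2 h), bytag_eval Φ _ (by norm_num)]; simp [arityT]

/-- The depth of `V`. [cite: KoiranPerifel2009VPSPACE, §3.2] -/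
theorem depth_V (h : WF Φ n len [29, s, f1, f2, f3, f4, f5, f6]) : depthX.eval (aenv Φ.params n len [29, s, f1, f2, f3, f4, f5, f6]) = ((4 * (Φ.F n)) + 22) := by
  rw [depthX, eval_cond_pos, if_pos ((wf_iff Φ ..).2 h), bytag_eval Φ _ (by norm_num)]; simp [depthT]

/-- The children of `V`. [cite: KoiranPerifel2009VPSPACE, §3.2] -/
theorem child_V (k : ℕ) : childX.map (AExp.eval (aenvK Φ.params n len [29, s, f1, f2, f3, f4, f5, f6] k)) = [27, s, k, f1, 0, 0, 0, 0] := by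
  rw [childX_eval Φ (by norm_num)]; simp [chT]

/-! #### Tag 30: the constant `0` -/

/-- Well-formedness of `ZERO`. [cite: KoiranPerifel2009VPSPACE, §3.2] -/
theorem wf_ZERO : WF Φ n len [30, s, f1, f2, f3, f4, f5, f6] ↔ (GWF Φ n len 30 s f1 f2 f3 f4 f5 f6 ∧ (True)) := by
  simp only [WF, WFt, List.getD_cons_zero, List.getD_cons_succ]

/-- The kind of `ZERO`. [cite: KoiranPerifel2009VPSPACE, §3.2] -/
theorem kind_ZERO (h : WF Φ n len [30, s, f1, f2, f3, f4, f5, f6]) : kindX.eval (aenv Φ.params n len [30, s, f1, f2, f3, f4, f5, f6]) = 0 := by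
  rw [kindX, eval_cond_pos, if_pos ((wf_iff Φ ..).2 h), bytag_eval Φ _ (by norm_num)]; simp [kindT]

/-- The width of `ZERO`. [cite: KoiranPerifel2009VPSPACE, §3.2] -/
theorem width_ZERO (h : WF Φ n len [30, s, f1, f2, f3, f4, f5, f6]) : widthX.eval (aenv Φ.params n len [30, s, f1, f2, f3, f4, f5, f6]) = 0 := by
  rw [widthX, eval_cond_pos, if_pos ((wf_iff Φ ..).2 h), bytag_eval Φ _ (by norm_num)]; simp [widthT]

/-- The depth of `ZERO`. [cite: KoiranPerifel2009VPSPACE, §3.2] -/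
theorem depth_ZERO (h : WF Φ n len [30, s, f1, f2, f3, f4, f5, f6]) : depthX.eval (aenv Φ.params n len [30, s, f1, f2, f3, f4, f5, f6]) = 0 := by
  rw [depthX, eval_cond_pos, if_pos ((wf_iff Φ ..).2 h), bytag_eval Φ _ (by norm_num)]; simp [depthT]

end SyntaxTags

end KVC

end Literature.Computability.Complexity

end
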